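import Literature.MathematicalPhysics.QuantumFieldTheory.Balaban1983to89.T4RelativeComb
import Literature.MathematicalPhysics.QuantumFieldTheory.Balaban1983to89.T4BirthChartTransport
import Literature.MathematicalPhysics.QuantumFieldTheory.Balaban1983to89.T4RelativeCombWindow

/-!
# `Balaban1983to89.T4BlockTransport` — the birth-chart transport lemma COMPOSED with the relative comb gauge on `ℤ^d`:
# two-sided curvature (the printed (1.26) mechanism) carries an observable-attached term at the CURVATURE rate

Cell `pub-balaban`, T4-DAG §6 spine estimate NE1′ (= O3b/H2, "dressed stability in the observable-attached format"),
prover seat P1, technique "RG-trajectory comparison: extend [Balaban1987RG1] (2.18) term by term with the observable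
insertion, tracking μ-uniformity through the printed small-field bounds"; journal row `T4-O3.E-NE1′-PROVE-P1b*`
(continuation of `…-PROVE-P1*`), record `t4/T4-EST-NE1p-P1.md` (v1.3), unit `b2b-balaban-t4-ne1p-p1` gen 2.
v1.1 (APPEND-ONLY, gen 3, journal row `T4-O3.E-NE1′-PROVE-P1c*`, record v1.4): §9–§13 below and the PLACEMENT paragraph.
v1.2 (APPEND-ONLY, gen 3, same row): §14 — K-UNIFORMITY of the cube budget from the STRICT product `Λψτ ≤ ρ < 1` with
merely BOUNDED weights (`tubeBudget_of_strictRate`, `cubeBudget_of_chart_strict`, `cubeBudget_of_levelRate_strict`,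
`strict_room`: the cell's numbers give `ρ = L⁻¹`, constant `L/(L − 1)`); [arith] only.
v1.3 (APPEND-ONLY + one import line `…T4RelativeCombWindow` (pv04-g14, p185179/p185343), gen 3, same row): §15 — THE COMPLEX
WINDOW: `BlockRelP P L z` (block gauge relation with `P`-valued-on-the-block gauges; the (1.19)-TYPE invariance hypothesis,
B12 p.263 (1.19) quoted there CONTEXT ONLY), `block_transport_P` (§3 verbatim for such gauges), `relGauge_of_blockGaugeP`,
`window_bond_bound`, `block_transport_window` / `relGauge_window` (near-unitary pairs, constant `K·windowCost K d L·(d−1)(L−1)`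
from pv04-g14's `interior_bound_window` BY NAME) — the transport-level half of the carved residual OG1′-RESID° (i) for
unfactorised pairs (factorised pairs: §3 applies as it stands, see the §15 scope note). [folklore]
v1.4 (APPEND-ONLY, imports unchanged, gen 3, same row): §16 — THE FACTORISED PRESENTATION at transport level:
`factorised_bond_bound`, `block_transport_factorised`, `relGauge_factorised` (pairs `Wᵢ ⊙ Uᵢ` with unitary-like parts: §3's
`block_transport` with §2's `BlockRel` and the comb gauge of the unitary parts; interior bound from pv04-g14's
`factorised_interior_bound_crude` BY NAME; LINEAR constants, no window cost). [folklore]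

CITATION HEADER (lean-in-tree rule 2026-08-18).  This file COMPOSES, by name, three certified tree modules —
`T4BirthChartTransport` (Cauchy along the birth slice ∘ gauge quotient, abstract data), `T4RelativeComb` (the relative
staircase-comb gauge of a pair of unitary-valued configurations on a block of `ℤ^d`, `C_P = (d−1)(L−1)`) and, at
booking level, `T4TermFormat` — and adds [folklore] identities / [arith] rate lemmas.  The printed sentences it leans
on are COPIED from the certified headers of `T4BirthChartTransport` (v1.1, XREAD C-pv20-33), `T4RelativeComb` and
`B8Lemma1Lattice` (census C-B8-33), where the renders read are named; they are CONTEXT.  The papers are manuscripts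
UNDER ADJUDICATION by the cell; NOTHING of them is asserted: every hypothesis below is a binder on abstract data.
PRINTED ([Balaban1985RegularSpaces] p. 77): "|U(∂p) − 1| < α₀L^{−2j} for p ∈ Ω_j, j = 0, 1, …, k, (1.7)";
(p. 79, proof of Lemma 1): "From (1.22) and the assumptions we have |(∂_{V₀}V′)(p) − 1| ≦ |V₀(∂p) − 1| +
|(V′V₀)(∂p) − 1| < 2α₀L⁻². (1.26) The conditions (R₀V′)(Γ_{y,x}) = 1, x ∈ B(y), imply V′_b = 1 for b ⊂ Γ_{y,x}. This
and the above estimate imply |V′_b − 1| < (d − 1)(L − 1)2α₀L⁻² for b ⊂ B(y)".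
PRINTED ([Balaban1987RG1] p. 262): "(i) 𝐔 = U′U, U has values in the group G, |∂U − 1| < α₀ξ² on X, (1.11)",
"(iii) The configurations 𝐔, 𝐉 satisfy the bounds |∂𝐔 − 1| < α₀ξ², |𝐉| < γ₀ on X. (1.14)"; p. 263: "positive,
absolute constants α₀, α₁ (i.e., constants independent of X and j)"; "𝐄^{(j)}(X, g_{j−1}, 𝐔^u, R(u)𝐉) =
𝐄^{(j)}(X, g_{j−1}, 𝐔, 𝐉) (1.19) for all Gᶜ-valued gauge transformations u."; p. 260: "The k-th action A_k(V) depends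
on V through the minimal configuration U_k(V), A_k(V) = A_k(U_k(V))"; p. 277: "(3.32) |A|, |∇^ηA|, ‖A‖_{1,β} <
2(α₂ + B₃O(1)Mα₀)", "|B| < O(1)L^{j}η", "(3.37) … |u_j − 1| < B₃²O(1)Mα₀. Assume now that B₃²O(1)Mα₀ < ½α₁, then the
orbit of the configuration U_j(□₀, …) above contains the configuration exp iξH_j(…) satisfying the conditions (i),
(ii) on the cube □̃³, hence on X."
[cite: Balaban1985RegularSpaces, (1.7) p.77, Lemma 1 (1.24)–(1.26) p.79] [cite: Balaban1987RG1, (1.10)–(1.19)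
pp.262–263, (3.30)–(3.37) pp.276–277]

HONEST FRAMING (cell `pub-balaban`, T4-DAG PAGE 1).  The cell's T4 target is the existence AND uniqueness of the
continuum limit of Bałaban's unit-scale averaged loop expectations on a FINITE four-torus, at rung (B)+1 of the cell's
ladder — CONDITIONAL on the perturbative β-function hypothesis BetaPertH and on the running-coupling hypotheses
(B)/(B^μ) wherever a consumer uses them (none is used IN this file); it is NOT an infinite-volume statement, NOT the
Yang–Mills mass gap and NOT the Clay problem.  NO statement about Bałaban's renormalization-group objects is asserted:
birth slice, gauge invariance, curvature bounds, rates and booking data are HYPOTHESIS SHAPES / binders.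

THE QUESTION LEFT BY THE LINEAGE.  `T4BirthChartTransport` proved, on abstract data, `‖Fn U₁ − Fn U₀‖ ≤ (4A/r)·δ`
for a gauge-invariant birth function with a birth slice of radius `r`, whenever `U₁` is gauge-related to a chart image
of `U₀` along a direction of window norm `δ` (`transport_of_birthChart`), and fed `δ ≤ c·φ^{k−j}` (`DefectRate`) into
the cell's booking (`cubeBudget_of_chart`, product `Λ·φ·θ₁ = L⁻¹`).  Two things were left as SLOTS (its header, (2) and
item (b)): the relative gauge with a LINEAR ladder constant `C_P`, and the INPUT (I4) that "the curvature CHANGE of the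
moved configuration is O((L^{j}η)²) in the j-frame (2-form scaling)" — flagged there (READING NOTE O2) as "NOT among
the printed window bounds (3.31)/(3.32)".  Meanwhile `T4RelativeComb` (pv04-g13) kernel-proved the comb gauge on `ℤ^d`
with `C_P = (d−1)(L−1)` and TWO per-square inputs: FINE `p + 2tq` and CRUDE `q₁ + q₀`.

WHAT THIS FILE ADDS (kernel-checked; new sibling leaf; imports `T4RelativeComb`, `T4BirthChartTransport` BY NAME;
nothing above is edited).
§1 The lattice chart: fields `Fld = (ℤ^d → Fin d → R)`, `val U` (units ↦ ring), directions with a sup bound `NDir`,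
   `latN`, the AFFINE chart `latMove U p t = U + t·D` (`latMove_zero`, `latMove_one_apply`).
§2 The block gauge relation `BlockRel L z U V` (∃ unitary-like `g`, `V = g·U·g⁻¹` on the bonds of the block `B(z)`):
   `blockRel_refl`, `blockRel_of_eqOn`, `blockRel_gaugeAct`, `blockRel_gaugeAct_symm`.
§3 THE COMPOSITION `block_transport`: `GaugeInvariant (BlockRel L z) Fn` + `BirthSlice Fn latMove latN 𝒦 w r A` +
   `val U₀ ∈ 𝒦` + ANY unitary-like block gauge `g` with `‖(U₁^g − U₀)(b)‖ ≤ δ ≤ w` on the bonds of `B(z)` ⇒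
   `‖Fn U₁ − Fn U₀‖ ≤ (4A/r)·δ` (the direction is `U₁^g − U₀` restricted to the block; `δ = 0` by `sub_eq_zero_of_rel`);
   instances `block_transport_raw` (`g = 1`, the raw rate) and `block_transport_comb` (`g` = the comb gauge of
   `T4RelativeComb.relative_comb_gauge`, `δ ≥ (d−1)(L−1)(p + 2·d(L−1)ε·q)`); `pureGauge_sub_eq_zero` (`Fn(U^h) = Fn U`).
§4 THE COMB DEFECT OF A PURE-GAUGE PAIR [folklore identities]: `hol_gaugeAct` (holonomy covariance), `relGauge_pureGauge`,
   `defect_pureGauge`: for `U₁ = U₀^h` the comb defect of the bond at `z+k` is the transported COMMUTATOR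
   `hol⁻¹·(h(z)·H·h(z)⁻¹·H⁻¹)·hol`, `H = loopHol U₀ z k ν` (the lasso holonomy), and `norm_defect_pureGauge_sub_one_le`:
   `‖W − 1‖ ≤ 2‖h(z) − 1‖·‖H − 1‖` — the corner normalisation `g(z) = 1` of the comb gauge charges transport × curvature
   to a pair whose optimal block gauge has `δ = 0`; this is where the FINE bound's cross term `2tq` lives (it measures
   the RELATIVE lasso holonomies of the pair, a joint-gauge invariant, not the orbit distance).  §8 attains the factor 2.
§5 THE CRUDE INSTANCE `block_transport_crude`: both configurations unitary-like with based-plaquette deviation `≤ q₁`,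
   `≤ q₀` on `B(z)` (`T4RelativeComb.interior_bound_crude`, the (1.26) mechanism, BY NAME), `δ ≥ (d−1)(L−1)(q₁ + q₀)`
   ⇒ `‖Fn U₁ − Fn U₀‖ ≤ (4A/r)·δ`.  NO information on the deviation `U₁ − U₀` enters: THE TRANSPORT RATE IS THE RATE OF
   THE TWO CURVATURE BOUNDS.
§6 RATES [arith]: `crude_envelope_le` (`q_i ≤ a_i·ψⁿ` ⇒ `C(q₁+q₀) ≤ C(a₁+a₀)·ψⁿ`); `comb_envelope_le` (the fine envelope
   is TWO-RATE: `p ≤ c_p·φⁿ`, `ε ≤ c_ε·νⁿ`, `q ≤ c_q·ψⁿ` ⇒ `≤ C(c_p·φⁿ + 2T·c_ε·c_q·(νψ)ⁿ)`, the cross part at the PRODUCT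
   rate transport × curvature); `twoRate_le_of_le`, `comb_envelope_perp` (`νψ ≤ φ` ⇒ the fine envelope is `φ`-rate);
   and the dead end `not_eventually_perpRate`: were the base curvature read `n`-INDEPENDENTLY (`ψ = 1`, cross part at
   `ν = L⁻¹ > φ = L⁻²`), no constant would make the fine envelope `φ`-rate (`(ν/φ)ⁿ` unbounded).
§7 BOOKING SEAM, by name into `T4BirthChartTransport` §4: HYPOTHESIS SHAPE (I4′) `CurvRate q a ψ` (`q b k ≤
   a·ψ^{k−j}`), `defectRate_of_crude : DefectRate defect (C(a₁+a₀)) ψ`, `defectRate_of_comb : DefectRate defect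
   (C(c_p + 2T·c_ε·c_q)) φ` (under `νψ ≤ φ`), and END TO END `cubeBudget_of_crude`: chart bound + birth sup + two-sided
   `CurvRate` at `ψ` + positional count + weights + `Λ·ψ·τ ≤ 1` ⇒ `CubeBudget wt ((N₀·(4Â·C(a₁+a₀)/r))·W)` — with the
   cell's numbers `ψ = φ = L⁻²`, `Λ = L⁴`, `τ = θ₁ = L⁻³` the product is `L⁻¹` (`T4BirthChartTransport.product_perp_le_one`,
   strict regeneration room `product_perp_regen_lt_one_iff`).  Every input is a binder.
§8 Non-vacuity (the zero functional inhabits §3 on `ℤ^d`) and the quaternion witness `‖c·H·c⁻¹·H⁻¹ − 1‖ = 2` (`c = i`,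
   `H = j` in `ℍ`), attaining the factor of `norm_defect_pureGauge_sub_one_le`.
v1.1 ADDITIONS (gen 3; every decl [folklore]/[arith] on abstract data, nothing above edited).
§9 NON-ABELIAN STOKES TELESCOPING on an abstract grid of group elements (`rowHol`, `colHol`, `cell`, `strip`, `rect`):
   the exact prepend/append conjugation identities `strip_succ`, `rect_succ` (`group`), the abelian model `rect_eq_prod`
   (rectangle = product of enclosed cells), and for unitary-like data in a normed ring the telescoped bounds
   `norm_strip_sub_one_le` (`≤ n·α`) and `norm_rect_sub_one_le` (`‖rect(n,m) − 1‖ ≤ n·m·α` when every enclosed cell is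
   within `α` of `1`).  Not in the tree before: `B7Prop1Explicit.asum_rectWord` is the ADDITIVE identity and
   `B7Prop1Explicit.ladder_bound` the `1 × |Q|` strip for words (neither imported here).
§10 On `ℤ^d` (`T4RelativeComb.Cfg` carriers): grid data `gridH`/`gridV`, the rectangle holonomy `rectHol` (`rectHol_eq`:
   four straight sides `segHol`; `rectHol_one_one = plaq`), `norm_rectHol_sub_one_le`; the BLOCKED configuration
   `blockCfg N U` (coarse bond = ordered product of `N` fine bonds), `plaq_blockCfg : plaq (blockCfg N U) y = rectHol U
   (N·y) N N`, the DERIVED 2-form law `norm_plaq_blockCfg_sub_one_le` (`≤ N²·α`), `plaqSup_blockCfg`, and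
   `block_transport_crude_blocked` (§5 for blocked pairs: `(d−1)(L−1)·N²(α₁+α₀) ≤ δ ≤ w ⇒ ≤ (4A/r)·δ`).
§11 INHABITING `CurvRate` — the two [arith] seams between a LEVEL bound and the birth-relative rate: `curvRate_of_levelRate`
   (same lattice: `q b k ≤ a·ψ^k`, `ψ ≤ 1` ⇒ `CurvRate q a ψ`), `curvRate_of_blocked` (`q b k ≤ N_b²·c·ψ^k`,
   `N_b²·ψ^{j_b} ≤ 1` ⇒ `CurvRate q c ψ`; `blocking_budget`: `(L^{j})²·(L⁻²)^{j} = 1`), and END TO END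
   `cubeBudget_of_levelRate` (= `cubeBudget_of_crude` with both `CurvRate` binders discharged by level bounds).
§12 API (XREAD C-pv06g13-2 R1): `relGauge_of_blockGauge` (a unitary-like block gauge with window `δ > 0` IS a
   `T4BirthChartTransport.RelGauge (BlockRel L z) latMove latN` witness — the construction inside `block_transport`,
   exported) and `relGauge_crude` (the comb-gauge instance), so that `chartBound_of_response`'s witness shape, hence
   the binder `hCB : ChartBound` of `cubeBudget_of_crude`, is reachable by name.
§13 Non-vacuity of §9 on the flat grid.

PLACEMENT OF (I4′) (v1.1; cell GAPS G-ne1p1-4 ANSWERED by the literature seat t4-lit1, `t4/CITED-FACTS-T4.md` v1.2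
A-t4lit1-1 and A-t4lit1-1a, F-T4-64 and F-T4-65; B12 pp. 261–263 render-read by this unit, gen 3).  CONTEXT ONLY — `CurvRate` stays a
binder.  PRINTED: [Balaban1987RG1] (1.6) p. 261 "A_k(U_k) = −(1/g_k²)A(U_k) + Σ_{j=0}^{k−1}{−β_{j+1}(g_j)A(U_k) +
[𝐄^{(j+1)}(g_j, U_k) − 𝐄^{(j+1)}(g_j, 1)]}" (every carried term is evaluated AT the current `U_k`); p. 263 "These
assumptions imply that the action A_k(U) defined on the space U_k(ε₀), which is contained in all the spaces
𝔘ᶜ_j(X, α₀, α₁), is gauge invariant"; p. 263 "We have M˙(𝐔) = Ū^p on Λ_p, |∂Ū^p − 1| < 2α′₀(L^pξ)²." (with (1.15)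
p. 262 "M˙(𝐔, b) = M^p(𝐔, b) = Ū^p(b) for b ∈ Λ_p"); [Balaban1985Averaging] p. 26 (COPIED from F-T4-65, render
re-checked here): "Each averaging operation rescales a bound on plaquette variables approximately by the factor L²,
hence k operations by the factor L^{2k}. To get some small number yet, we have to assume that |U(∂p) − 1| < α₀η²,
η = L^{−k} (52)", Proposition 2 "|Ū^k(∂p) − 1| < α₀ + 2C₀α₀² < 2α₀, p ⊂ Ω^{(k)}. (54)" (tree: `B7.Prop2Printed`,
kernel `B7Prop2Explicit.prop2_explicit`, not imported here).  TWO WORDING CORRECTIONS adopted from A-t4lit1-1a: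
(i) [Balaban1985cUVStability3D] Thm 1 (9) fixes the level of its class cubes BY POSITION (cubes near ∂Ω_k are
level-(k−1) cubes; a collar of width 2R₁M₁·L^{k}η is needed before level-k bounds apply); (ii) the law `a·L^{−2(k−j)}`
is PRINTED for j-fold AVERAGES ((53)/(54), p. 263 above) and DERIVED — unitary telescoping, §9–§10 of this file — for
the holonomy of a side-`L^{j}η` plaquette of the fine field ([arith]/[folklore] with (1.7)/(8)/(52) as premise).
THE TWO READINGS of a carried term's arguments and their seams [cell]: SAME LATTICE (p. 261 (1.6), p. 263
containment: birth window `α₀ξ_j²` vs current `ε₀η²` PER FINE PLAQUETTE, ratio `(ε₀/α₀)·L^{−2(k−j)}`; seam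
`curvRate_of_levelRate`, no Stokes needed) and BLOCKED / AVERAGED (arguments on the `L^{j}η`-lattice: `N = L^{j}`
fine bonds per bond, `N²·ε₀η² = ε₀L^{−2(k−j)}`; seam `curvRate_of_blocked` + §10, or the printed (53)/(54) for `Ū^j`).
Either way the RATE is `φ = L⁻²` with a `j, k`-uniform constant; which reading a consumer's term format uses is the
DOMAIN-MATCH bookkeeping of record §4 (O2e), not decided here.

THE READING THIS SUPPORTS (the cell's, labelled [cell]; NOT asserted).  (I4) IS REPLACED BY (I4′) = TWO-SIDED
REGULARITY READ IN THE BIRTH FRAME.  The carried term is the birth function (p. 260, `T4Spectator`); at scale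
`k = j + n` its two arguments — the current configuration without / with the unit scale-`k` fluctuation — live on the
SAME lattice as at birth, and the printed-shape regularity of scale-`k` configurations ((1.11)/(1.14) "|∂U − 1| < α₀ξ²"
with the CURRENT `ξ`; (1.7) "α₀L^{−2j} … j = 0, 1, …, k": deeper scale, tighter plaquette bound; the partner through the
window (3.32) on `∇^ηA` and the orbit statement (3.37)) is, per plaquette of the birth block, a bound `a·L^{−2n}`:
2-FORM SCALED BECAUSE REGULARITY AT SCALE k IS STRONGER THAN AT SCALE j BY `L^{−2(k−j)}` PER PLAQUETTE — the SHAPE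
`CurvRate q a φ`.  Then §5 + §7 give the transverse defect `δ_n ≤ (d−1)(L_blk−1)·(a₁+a₀)·φⁿ` (block side `L_blk` and
`a_i = O(α₀ξ_j²)`, `O((α₀+α₂)ξ_j²)` are BIRTH data, `n`-independent) and the response `(4A/r)·δ_n` at rate `φ = L⁻²`
with a `j, k, K, μ`-uniform constant — WITHOUT any statement on the deviation `U₁ − U₀` (no (I4), no 2-form scaling of
`B = Q(ηA)`, no covariant-curl bound `a′`).  Units: `latN`, `δ`, `w`, `r` are in bond-variable units (a common factor
`ξ_j` against Bałaban's connection norms, cancelling in `(4A/r)·δ`); the window condition `δ ≤ w` is a smallness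
relation of the type "(3.37) B₃²O(1)Mα₀ < ½α₁" among birth constants.  The FINE route (first order in the fluctuation:
`p`, `ε ∝ |B| < O(1)L^{j}η`) then has its cross term at rate `ν·φ = L⁻³` (§6), harmless; it is needed only for
constants PROPORTIONAL to the fluctuation, not for the size budget.

WHAT THIS FILE DOES NOT CLAIM (OPEN; record §4, GAPS G-ne1p1-4).  (a) That Bałaban's / the cell's carried arguments
INHABIT `CurvRate` on the birth blocks (the regularity of `U_k(V)` and of its fluctuation partner read in the j-frame —
printed-shape, to be PLACED by the literature seats with page references; here a binder), nor (I1)–(I3) = O-β3-b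
(birth slice with `j`-independent radius, invariance, birth sup of the cell's D-terms).  (b) Anything beyond ONE
BLOCK in SUP NORM for UNITARY-valued pairs: no Hölder/derivative window norms (O2a), no patching across blocks /
`M`-cubes (O2b), no complex (Gᶜ-valued) pairs — there every conjugation costs `‖u‖‖u⁻¹‖`
(`T4AxialChain.norm_conj_sub_one_le`) — and `BlockRel` as typed (unitary-like `g`) is the G-valued invariance only
(WEAKER than (1.19), so the hypothesis on `Fn` is weaker too).  (c) The regeneration constant of ℝ-steps (O-G2), pairs,
draw profile, rung > (B)+1.  (d) That the affine chart `U + tD` is the cell's exponential chart — `BirthSlice Fn latMove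
latN` is a hypothesis on `Fn` in THIS chart; an instantiator with `exp(iξt𝐀)U` re-proves §3 with its own `move` via
`transport_of_birthChart` directly.
Value = a kernel composition (function level on `ℤ^d` → booking → cube budget, every input a named binder) + the
observation that the CRUDE per-square input makes the deviation-scaling input (I4) unnecessary for the RATE + the
located reason (pure-gauge commutator, two-rate envelope) why the fine constant is a different question; NOT summit
progress.

LABELS. [printed] = quoted above (context); [folklore] = finite group identities, triangle inequalities, Cauchy-estimate
bookkeeping on abstract data; [arith] = real arithmetic; [cell] = the cell's reading (NEVER asserted in Lean).  No
`sorry`, no new axioms.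
-/

namespace Literature.MathematicalPhysics.QuantumFieldTheory.Balaban1983to89.T4BlockTransport

open Set
open B8Lemma1Lattice (e site site_add_single InBlock)
open T4RelativeLadder (UnitaryLike norm_conj_sub_le norm_conj_sub_one_eq)
open T4RelativeComb (Cfg gaugeAct plaq PlaqSup combGauge combGauge_site relGauge hol hol_zero hol_succ defect
  pred' low isTree_pred' pred'_add_single sum_eq_sum_pred'_succ relative_comb_gauge)
open T4BirthChartTransport (GaugeInvariant BirthSlice RelGauge transport_of_birthChart sub_eq_zero_of_rel)

variable {R : Type*} [NormedRing R] {d : ℕ}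

/-! ## §1  `R`-valued bond fields, the AFFINE lattice chart, directions with a declared sup bound -/

/-- [folklore] Sites of `ℤ^d` — the SAME carrier as `B8Lemma1Lattice.Site d` / `T4RelativeComb.Site d` (definitionally;
re-declared in this namespace only so that the bare name is not captured by unrelated `Site`s of ancestor namespaces). -/
abbrev Site (d : ℕ) : Type := Fin d → ℤ

example (d : ℕ) : Site d = T4RelativeComb.Site d := rfl

/-- [folklore] `R`-VALUED bond fields on `ℤ^d` — the carrier on which the carried (birth) function is defined and along
which the affine chart moves; unit-valued configurations `T4RelativeComb.Cfg d R` embed by `val`. -/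
abbrev Fld (d : ℕ) (R : Type*) : Type _ := Site d → Fin d → R

/-- [folklore] Forget that bond variables are units. -/
def val (U : Cfg d R) : Fld d R := fun x ν => (U x ν : R)

/-- [folklore] `val` evaluates to the underlying ring element. -/
@[simp] theorem val_apply (U : Cfg d R) (x : Site d) (ν : Fin d) : val U x ν = (U x ν : R) := rfl

/-- [folklore] DIRECTIONS WITH A DECLARED SUP BOUND: a bond field `D` together with a real `s` dominating `‖D⟨x,x+e_ν⟩‖`
on EVERY bond (the window norm slot `N` of `T4BirthChartTransport.BirthSlice` is read as the declared bound; declaring a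
larger bound only shrinks the disc the slice hypothesis speaks about). -/
def NDir (d : ℕ) (R : Type*) [NormedRing R] : Type _ := {p : Fld d R × ℝ // ∀ x ν, ‖p.1 x ν‖ ≤ p.2}

/-- [folklore] The declared sup bound of a direction. -/
def latN (p : NDir d R) : ℝ := p.1.2

/-- [folklore] The declared bound dominates the direction bond-wise. -/
theorem norm_dir_le (p : NDir d R) (x : Site d) (ν : Fin d) : ‖p.1.1 x ν‖ ≤ latN p := p.2 x ν

section Chart

variable [NormedAlgebra ℂ R]

/-- [folklore] THE AFFINE LATTICE CHART: `t ↦ U + t·D` bond-wise (no exponential, no logarithm: at function level the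
gauge-quotient transport needs only a complex segment from `U₀` to a configuration agreeing with `U₁^g` on the block). -/
def latMove (U : Fld d R) (p : NDir d R) (t : ℂ) : Fld d R := fun x ν => U x ν + t • p.1.1 x ν

/-- [folklore] The chart starts at the base. -/
theorem latMove_zero (U : Fld d R) (p : NDir d R) : latMove U p 0 = U := by
  funext x ν; simp [latMove]

/-- [folklore] The chart at `t = 1` is `U + D`. -/
theorem latMove_one_apply (U : Fld d R) (p : NDir d R) (x : Site d) (ν : Fin d) :
    latMove U p 1 x ν = U x ν + p.1.1 x ν := by
  simp [latMove]

end Chart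

/-! ## §2  The block gauge relation: interior bonds of `B(z)`, unitary-like gauge transformations -/

/-- [folklore] THE BLOCK GAUGE RELATION on `R`-valued bond fields: `V` is, ON THE INTERIOR BONDS of the block `B(z) =
z + {0,…,L−1}^d` (both endpoints in `B(z)`), the gauge transform of `U` by SOME unitary-like `g : ℤ^d → Rˣ`.  A function
`Fn` with `T4BirthChartTransport.GaugeInvariant (BlockRel L z) Fn` is therefore (i) invariant under unitary-like (G-valued)
gauge transformations and (ii) LOCAL: it depends on the interior bonds of `B(z)` only (take `g = 1`).  Only this much
invariance is used below — no complex (Gᶜ-valued) gauge transformation enters. -/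
def BlockRel (L : ℕ) (z : Site d) (U V : Fld d R) : Prop :=
  ∃ g : Site d → Rˣ, (∀ x, UnitaryLike (g x)) ∧
    ∀ x ν, InBlock L z x → InBlock L z (x + e ν) → V x ν = (g x : R) * U x ν * (((g (x + e ν))⁻¹ : Rˣ) : R)

variable {L : ℕ} {z : Site d}

/-- [folklore] Reflexivity (`g = 1`). -/
theorem blockRel_refl [NormOneClass R] (L : ℕ) (z : Site d) (U : Fld d R) : BlockRel L z U U :=
  ⟨fun _ => 1, fun _ => UnitaryLike.one, fun x ν _ _ => by simp⟩

/-- [folklore] Two fields agreeing on the interior bonds of `B(z)` are related (locality). -/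
theorem blockRel_of_eqOn [NormOneClass R] {U V : Fld d R} (h : ∀ x ν, InBlock L z x → InBlock L z (x + e ν) → V x ν = U x ν) :
    BlockRel L z U V :=
  ⟨fun _ => 1, fun _ => UnitaryLike.one, fun x ν hx hxν => by simp [h x ν hx hxν]⟩

/-- [folklore] A unitary-like gauge transform is related to the original … -/
theorem blockRel_gaugeAct {g : Site d → Rˣ} (hg : ∀ x, UnitaryLike (g x)) (U : Cfg d R) :
    BlockRel L z (val U) (val (gaugeAct g U)) :=
  ⟨g, hg, fun x ν _ _ => by simp [gaugeAct]⟩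

/-- [folklore] … and conversely (by `g⁻¹`). -/
theorem blockRel_gaugeAct_symm {g : Site d → Rˣ} (hg : ∀ x, UnitaryLike (g x)) (U : Cfg d R) :
    BlockRel L z (val (gaugeAct g U)) (val U) := by
  refine ⟨fun x => (g x)⁻¹, fun x => (hg x).inv, fun x ν _ _ => ?_⟩
  have h : U x ν = (g x)⁻¹ * gaugeAct g U x ν * ((g (x + e ν))⁻¹)⁻¹ := by
    simp only [gaugeAct]; group
  simpa using congrArg Units.val h

/-! ## §3  The block transport theorem (∀ block gauge), its raw and comb instances, pure-gauge pairs -/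

section Transport

variable [NormedAlgebra ℂ R] {F : Type*} [NormedAddCommGroup F] [NormedSpace ℂ F] [CompleteSpace F]
variable {Fn : Fld d R → F} {𝒦 : Set (Fld d R)} {w r A : ℝ}

/-- **THE BLOCK TRANSPORT THEOREM (∀ block gauge).**  A block functional `Fn` invariant under the block gauge relation
of `B(z)` and obeying a birth slice of radius `r`, sup `A`, window `w` on the affine chart, a base `U₀` in the regular
set `𝒦`, ANY configuration `U₁` and ANY unitary-like gauge `g` with `‖(U₁^g)⟨b⟩ − U₀⟨b⟩‖ ≤ δ ≤ w` on the interior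
bonds `b` of `B(z)`: `‖Fn U₁ − Fn U₀‖ ≤ (4A/r)·δ`.  The direction fed to `transport_of_birthChart` is the interior
restriction of `U₁^g − U₀` with declared bound `δ`; for `δ = 0` the pair is block-gauge related and the difference
vanishes.  The infimum over `g` of the admissible `δ` is the block gauge-orbit sup distance; every analytic input is a
hypothesis. [folklore] -/
theorem block_transport (hinv : GaugeInvariant (BlockRel L z) Fn) (hsl : BirthSlice Fn latMove latN 𝒦 w r A)
    (hr : 0 < r) (hA : 0 ≤ A) {U₀ U₁ : Cfg d R} (hU₀ : val U₀ ∈ 𝒦) {g : Site d → Rˣ}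
    (hg : ∀ x, UnitaryLike (g x)) {δ : ℝ} (hδ : 0 ≤ δ) (hδw : δ ≤ w)
    (hdef : ∀ x ν, InBlock L z x → InBlock L z (x + e ν) → ‖(gaugeAct g U₁ x ν : R) - U₀ x ν‖ ≤ δ) :
    ‖Fn (val U₁) - Fn (val U₀)‖ ≤ 4 * A / r * δ := by
  classical
  rcases hδ.eq_or_lt with h0 | hpos
  · subst h0
    have hrel : BlockRel L z (val U₁) (val U₀) := by
      refine ⟨g, hg, fun x ν hx hxν => ?_⟩
      have h := hdef x ν hx hxν
      rw [norm_le_zero_iff, sub_eq_zero] at h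
      rw [val_apply, ← h]
      simp [gaugeAct]
    rw [sub_eq_zero_of_rel hinv hrel, norm_zero, mul_zero]
  · let D : Fld d R := fun x ν =>
      if InBlock L z x ∧ InBlock L z (x + e ν) then (gaugeAct g U₁ x ν : R) - U₀ x ν else 0
    have hD : ∀ x ν, ‖D x ν‖ ≤ δ := fun x ν => by
      by_cases h : InBlock L z x ∧ InBlock L z (x + e ν)
      · simp only [D, if_pos h]; exact hdef x ν h.1 h.2
      · simp only [D, if_neg h, norm_zero]; exact hδ
    let dir : NDir d R := ⟨(D, δ), hD⟩
    have hrel : BlockRel L z (val U₁) (latMove (val U₀) dir 1) := by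
      refine ⟨g, hg, fun x ν hx hxν => ?_⟩
      rw [latMove_one_apply, val_apply]
      show (U₀ x ν : R) + D x ν = _
      simp only [D, if_pos (And.intro hx hxν), gaugeAct, Units.val_mul, val_apply]
      abel
    exact transport_of_birthChart hinv hsl latMove_zero hr hA hU₀ ⟨dir, hpos, le_rfl, hrel⟩ hδw

/-- [folklore] THE RAW INSTANCE (`g = 1`): bond deviation `‖U₁ − U₀‖ ≤ ε ≤ w` on the interior of `B(z)` gives
`‖Fn U₁ − Fn U₀‖ ≤ (4A/r)·ε` — the raw birth-chart rate of `T4BirthChartTransport.slice_bound`, now on the lattice. -/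
theorem block_transport_raw [NormOneClass R] (hinv : GaugeInvariant (BlockRel L z) Fn) (hsl : BirthSlice Fn latMove latN 𝒦 w r A)
    (hr : 0 < r) (hA : 0 ≤ A) {U₀ U₁ : Cfg d R} (hU₀ : val U₀ ∈ 𝒦) {ε : ℝ} (hε : 0 ≤ ε) (hεw : ε ≤ w)
    (hdev : ∀ x ν, InBlock L z x → InBlock L z (x + e ν) → ‖(U₁ x ν : R) - U₀ x ν‖ ≤ ε) :
    ‖Fn (val U₁) - Fn (val U₀)‖ ≤ 4 * A / r * ε :=
  block_transport hinv hsl hr hA hU₀ (g := fun _ => 1) (fun _ => UnitaryLike.one) hε hεw fun x ν hx hxν => by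
    simpa [gaugeAct] using hdev x ν hx hxν

/-- **THE COMB INSTANCE** (`g` := the relative comb gauge of `T4RelativeComb.relative_comb_gauge`, pv04-g13, BY NAME):
for unitary-like `U₀ ∈ 𝒦`, `U₁` with bond deviation `≤ ε`, RAW relative plaquette deviation `≤ p` and base curvature
`≤ q` on `B(z)`, and any `δ` with `(d−1)(L−1)·(p + 2·(d(L−1)ε)·q) ≤ δ ≤ w`: `‖Fn U₁ − Fn U₀‖ ≤ (4A/r)·δ`.  The three
sups are HYPOTHESES (the printed-shape small-field data of whoever instantiates); the constant `4A/r` is the birth data;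
`C_P = (d−1)(L−1)` is the kernel-counted ladder constant; the CROSS TERM `2·(d(L−1)ε)·q` is displayed (§5). [folklore] -/
theorem block_transport_comb [NormOneClass R] (hinv : GaugeInvariant (BlockRel L z) Fn)
    (hsl : BirthSlice Fn latMove latN 𝒦 w r A) (hr : 0 < r) (hA : 0 ≤ A) {U₀ U₁ : Cfg d R} (hU₀𝒦 : val U₀ ∈ 𝒦)
    (hU₀ : ∀ x ν, UnitaryLike (U₀ x ν)) (hU₁ : ∀ x ν, UnitaryLike (U₁ x ν)) {p q ε δ : ℝ} (hε : 0 ≤ ε)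
    (hdev : ∀ x ν, InBlock L z x → InBlock L z (x + e ν) → ‖(U₁ x ν : R) - U₀ x ν‖ ≤ ε)
    (hp : PlaqSup L z (fun y ρ ν => ‖(plaq U₁ y ρ ν : R) - plaq U₀ y ρ ν‖) p)
    (hq : PlaqSup L z (fun y ρ ν => ‖(plaq U₀ y ρ ν : R) - 1‖) q)
    (hpq : 0 ≤ p + 2 * ((d : ℝ) * ((L : ℝ) - 1) * ε) * q)
    (hCδ : ((d : ℝ) - 1) * ((L : ℝ) - 1) * (p + 2 * ((d : ℝ) * ((L : ℝ) - 1) * ε) * q) ≤ δ) (hδ : 0 ≤ δ)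
    (hδw : δ ≤ w) : ‖Fn (val U₁) - Fn (val U₀)‖ ≤ 4 * A / r * δ := by
  obtain ⟨g, -, hg, -, -, hW⟩ := relative_comb_gauge z hU₀ hU₁ hε hdev hp hq hpq
  refine block_transport hinv hsl hr hA hU₀𝒦 hg hδ hδw fun x ν hx hxν => ?_
  have e1 : (gaugeAct g U₁ x ν : R) - U₀ x ν =
      ((((gaugeAct g U₁ x ν * (U₀ x ν)⁻¹ : Rˣ)) : R) - 1) * (U₀ x ν : R) := by
    rw [sub_mul, one_mul, Units.val_mul, Units.inv_mul_cancel_right]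
  rw [e1]
  calc _ ≤ ‖(((gaugeAct g U₁ x ν * (U₀ x ν)⁻¹ : Rˣ)) : R) - 1‖ * ‖(U₀ x ν : R)‖ := norm_mul_le _ _
    _ ≤ ((d : ℝ) - 1) * ((L : ℝ) - 1) * (p + 2 * ((d : ℝ) * ((L : ℝ) - 1) * ε) * q) * 1 :=
        mul_le_mul (hW x ν hx hxν) (hU₀ x ν).1 (norm_nonneg _) (le_trans (norm_nonneg _) (hW x ν hx hxν))
    _ ≤ δ := by rw [mul_one]; exact hCδ

omit [NormedAlgebra ℂ R] [NormedSpace ℂ F] [CompleteSpace F] in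
/-- [folklore] PURE-GAUGE PAIRS CARRY THE SAME VALUE: `Fn (U^h) = Fn U` for unitary-like `h` — so for such a pair the
OPTIMAL block gauge is `g = h⁻¹` (`δ = 0` in `block_transport`), whatever the comb estimate of §4 says. -/
theorem pureGauge_sub_eq_zero (hinv : GaugeInvariant (BlockRel L z) Fn) {h : Site d → Rˣ}
    (hh : ∀ x, UnitaryLike (h x)) (U : Cfg d R) : Fn (val (gaugeAct h U)) - Fn (val U) = 0 :=
  sub_eq_zero_of_rel hinv (blockRel_gaugeAct_symm hh U)

end Transport

/-! ## §4  The comb defect of a PURE-GAUGE pair: the corner normalisation `g(z) = 1` costs a commutator -/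

/-- [folklore] GAUGE COVARIANCE OF THE COMB HOLONOMY: `U^h(Γ_{z,z+k}) = h(z)·U(Γ_{z,z+k})·h(z+k)⁻¹` (induction on the
path, one `hol_succ` per tree bond). -/
theorem hol_gaugeAct (h : Site d → Rˣ) (U : Cfg d R) (z : Site d) :
    ∀ k, hol (gaugeAct h U) z k = h z * hol U z k * (h (site z k))⁻¹ := by
  suffices H : ∀ n (k : Fin d → ℕ), ∑ ρ, k ρ = n → hol (gaugeAct h U) z k = h z * hol U z k * (h (site z k))⁻¹ from
    fun k => H _ k rfl
  intro n
  induction n with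
  | zero =>
      intro k hk
      have hk0 : k = 0 := by
        funext κ; exact (Finset.sum_eq_zero_iff.1 hk) κ (Finset.mem_univ κ)
      subst hk0
      have hz : site z (0 : Fin d → ℕ) = z := by funext κ; simp [site]
      rw [hol_zero, hol_zero, hz, mul_one, mul_inv_cancel]
  | succ n ih =>
      intro k hk
      obtain ⟨ρ₁, -, hρ₁⟩ : ∃ ρ ∈ (Finset.univ : Finset (Fin d)), k ρ ≠ 0 :=
        Finset.exists_ne_zero_of_sum_ne_zero (by omega)
      have hex : ∃ ρ, k ρ ≠ 0 := ⟨ρ₁, hρ₁⟩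
      have hn : ∑ ρ, pred' k hex ρ = n := by have := sum_eq_sum_pred'_succ k hex; omega
      have step : ∀ V : Cfg d R, hol V z k = hol V z (pred' k hex) * V (site z (pred' k hex)) (low k hex) := fun V => by
        conv_lhs => rw [← pred'_add_single k hex]
        exact hol_succ V z (isTree_pred' k hex)
      have hsite : site z (pred' k hex) + e (low k hex) = site z k := by
        rw [← site_add_single, pred'_add_single]
      rw [step, step, ih _ hn]
      simp only [gaugeAct, hsite]
      group

/-- [folklore] The relative comb gauge of a pure-gauge pair: `u(z+k) = U(Γ)⁻¹·h(z)·U(Γ)·h(z+k)⁻¹` — the corner value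
`h(z)` TRANSPORTED along the comb, times the inverse of the local gauge. -/
theorem relGauge_pureGauge (h : Site d → Rˣ) (U : Cfg d R) (z : Site d) (k : Fin d → ℕ) :
    relGauge U (gaugeAct h U) z k = (hol U z k)⁻¹ * h z * hol U z k * (h (site z k))⁻¹ := by
  rw [relGauge, hol_gaugeAct]; simp only [mul_assoc]

/-- [folklore] THE LOOP HOLONOMY of the base along the comb: `U(Γ_{z,z+k})·U⟨z+k, z+k+e_ν⟩·U(Γ_{z,z+k+e_ν})⁻¹` — the
holonomy of the closed path corner → `z+k` → `z+k+e_ν` → corner (trivial on tree bonds; on a non-tree bond it is the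
ordered product of the based plaquettes of the ladder below the bond, size `≤ ladderLen·q`). -/
def loopHol (U : Cfg d R) (z : Site d) (k : Fin d → ℕ) (ν : Fin d) : Rˣ :=
  hol U z k * U (site z k) ν * (hol U z (k + Pi.single ν 1))⁻¹

/-- **THE COMB DEFECT OF A PURE-GAUGE PAIR IS A TRANSPORTED GROUP COMMUTATOR** `W = U(Γ)⁻¹·[h(z), H]·U(Γ)` with
`[c, H] = c·H·c⁻¹·H⁻¹`, `H` the loop holonomy of the base: it is `1` iff the corner value `h(z)` commutes with `H`.  So
the corner normalisation `g(z) = 1` of the comb gauge charges a pure-gauge pair — whose physical size is ZERO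
(`pureGauge_sub_eq_zero`) — with a transverse defect of commutator size: part of the comb CROSS TERM of §5 is this
artefact, removed by the ∀-gauge form `block_transport`. [folklore] -/
theorem defect_pureGauge (h : Site d → Rˣ) (U : Cfg d R) (z : Site d) (k : Fin d → ℕ) (ν : Fin d) :
    defect U (gaugeAct h U) z (site z k) ν =
      (hol U z k)⁻¹ * (h z * loopHol U z k ν * (h z)⁻¹ * (loopHol U z k ν)⁻¹) * hol U z k := by
  rw [defect, gaugeAct, ← site_add_single, combGauge_site, combGauge_site, relGauge_pureGauge, relGauge_pureGauge,
    gaugeAct, site_add_single, loopHol]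
  group

/-- [folklore] … hence, for unitary-like data, `‖W − 1‖ ≤ 2·‖h(z) − 1‖·‖H − 1‖` (commutator size: corner deviation ×
loop curvature) — the SHAPE `2·t·q` of the comb cross term, attained on pure-gauge pairs. -/
theorem norm_defect_pureGauge_sub_one_le [NormOneClass R] {h : Site d → Rˣ} {U : Cfg d R} (hh : ∀ x, UnitaryLike (h x))
    (hU : ∀ x ν, UnitaryLike (U x ν)) (z : Site d) (k : Fin d → ℕ) (ν : Fin d) :
    ‖(defect U (gaugeAct h U) z (site z k) ν : R) - 1‖ ≤
      2 * ‖(h z : R) - 1‖ * ‖(loopHol U z k ν : R) - 1‖ := by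
  have hhol := T4RelativeComb.unitaryLike_hol hU z
  set Hl := loopHol U z k ν
  have e0 : ((hol U z k)⁻¹ * (h z * Hl * (h z)⁻¹ * Hl⁻¹) * hol U z k : Rˣ) =
      (hol U z k)⁻¹ * (h z * Hl * (h z)⁻¹ * Hl⁻¹) * ((hol U z k)⁻¹)⁻¹ := by rw [inv_inv]
  rw [defect_pureGauge, e0, Units.val_mul, Units.val_mul, norm_conj_sub_one_eq (hhol k).inv]
  have hH : UnitaryLike Hl := ((hhol k).mul (hU _ _)).mul (hhol _).inv
  have e2 : ((h z * Hl * (h z)⁻¹ * Hl⁻¹ : Rˣ) : R) - 1 =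
      (((h z * Hl * (h z)⁻¹ : Rˣ) : R) - Hl) * (((Hl⁻¹ : Rˣ)) : R) := by
    rw [sub_mul, Units.mul_inv, ← Units.val_mul]
  rw [e2]
  calc _ ≤ ‖((h z * Hl * (h z)⁻¹ : Rˣ) : R) - Hl‖ * ‖(((Hl⁻¹ : Rˣ)) : R)‖ := norm_mul_le _ _
    _ ≤ (‖(Hl : R) - Hl‖ + 2 * ‖(h z : R) - 1‖ * ‖(Hl : R) - 1‖) * 1 := by
        refine mul_le_mul ?_ hH.2 (norm_nonneg _) (by positivity)
        simpa only [Units.val_mul] using norm_conj_sub_le (hh z) (Hl : R) (Hl : R)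
    _ = 2 * ‖(h z : R) - 1‖ * ‖(Hl : R) - 1‖ := by rw [sub_self, norm_zero, zero_add, mul_one]

/-! ## §5  The CRUDE instance: two-sided curvature only — the printed (1.26) mechanism carries the transport -/

section Crude

variable [NormedAlgebra ℂ R] {F : Type*} [NormedAddCommGroup F] [NormedSpace ℂ F] [CompleteSpace F]
variable {Fn : Fld d R → F} {𝒦 : Set (Fld d R)} {w r A : ℝ}

/-- **THE CRUDE COMB INSTANCE** (`T4RelativeComb.interior_bound_crude`, the mechanism of [Balaban1985RegularSpaces]
(1.26), BY NAME): if BOTH unitary-like configurations have based-plaquette deviation `≤ q₀`, `≤ q₁` on the block `B(z)`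
(the SHAPE of the printed condition (1.7) "|U(∂p) − 1| < α₀L^{−2j}" read on the birth block), `U₀ ∈ 𝒦`, and
`(d−1)(L−1)·(q₁ + q₀) ≤ δ ≤ w`, then `‖Fn U₁ − Fn U₀‖ ≤ (4A/r)·δ`.  NO information on the deviation `U₁ − U₀` is used:
the RATE of the transport is the rate of the two curvature bounds (§6–§7: in the birth frame both are 2-form scaled,
`∝ φⁿ = L^{−2n}`), the constant is `C_P = (d−1)(L−1)` × birth data.  This is the kernel form of the transport lemma
(T-⊥) of record `t4/T4-EST-NE1p-P1.md` §3 with input (I4) REPLACED by two-sided regularity (I4′). [folklore] -/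
theorem block_transport_crude [NormOneClass R] (hinv : GaugeInvariant (BlockRel L z) Fn)
    (hsl : BirthSlice Fn latMove latN 𝒦 w r A) (hr : 0 < r) (hA : 0 ≤ A) {U₀ U₁ : Cfg d R} (hU₀𝒦 : val U₀ ∈ 𝒦)
    (hU₀ : ∀ x ν, UnitaryLike (U₀ x ν)) (hU₁ : ∀ x ν, UnitaryLike (U₁ x ν)) {q₀ q₁ δ : ℝ}
    (hq₁ : PlaqSup L z (fun y ρ ν => ‖(plaq U₁ y ρ ν : R) - 1‖) q₁)
    (hq₀ : PlaqSup L z (fun y ρ ν => ‖(plaq U₀ y ρ ν : R) - 1‖) q₀) (hq : 0 ≤ q₁ + q₀)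
    (hCδ : ((d : ℝ) - 1) * ((L : ℝ) - 1) * (q₁ + q₀) ≤ δ) (hδ : 0 ≤ δ) (hδw : δ ≤ w) :
    ‖Fn (val U₁) - Fn (val U₀)‖ ≤ 4 * A / r * δ := by
  refine block_transport hinv hsl hr hA hU₀𝒦 (T4RelativeComb.unitaryLike_combGauge hU₀ hU₁ z) hδ hδw
    fun x ν hx hxν => ?_
  have hW := T4RelativeComb.interior_bound_crude hU₀ hU₁ hq₁ hq₀ hq x ν hx hxν
  rw [defect] at hW
  have e1 : (gaugeAct (combGauge U₀ U₁ z) U₁ x ν : R) - U₀ x ν =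
      ((((gaugeAct (combGauge U₀ U₁ z) U₁ x ν * (U₀ x ν)⁻¹ : Rˣ)) : R) - 1) * (U₀ x ν : R) := by
    rw [sub_mul, one_mul, Units.val_mul, Units.inv_mul_cancel_right]
  rw [e1]
  calc _ ≤ ‖(((gaugeAct (combGauge U₀ U₁ z) U₁ x ν * (U₀ x ν)⁻¹ : Rˣ)) : R) - 1‖ * ‖(U₀ x ν : R)‖ := norm_mul_le _ _
    _ ≤ ((d : ℝ) - 1) * ((L : ℝ) - 1) * (q₁ + q₀) * 1 :=
        mul_le_mul hW (hU₀ x ν).1 (norm_nonneg _) (le_trans (norm_nonneg _) hW)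
    _ ≤ δ := by rw [mul_one]; exact hCδ

end Crude

/-! ## §6  Rates [arith]: crude = rate of the curvatures; fine = two-rate with the cross term at (rate ε)·(rate q) -/

section Rates

variable {C T p ε q q₀ q₁ a₀ a₁ c_p c_ε c_q κ φ ν ψ : ℝ} {n : ℕ}

/-- [arith] [folklore] THE CRUDE ENVELOPE: curvature bounds `q₁ ≤ a₁·ψⁿ`, `q₀ ≤ a₀·ψⁿ` give `C·(q₁ + q₀) ≤ C·(a₁ + a₀)·ψⁿ`
— the transport inherits the RATE OF THE CURVATURE BOUNDS.  In the birth frame the printed-shape regularity (1.7)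
is 2-form scaled, `ψ = φ = L⁻²` (§7 `CurvRate`). -/
theorem crude_envelope_le (hC : 0 ≤ C) (h₁ : q₁ ≤ a₁ * ψ ^ n) (h₀ : q₀ ≤ a₀ * ψ ^ n) :
    C * (q₁ + q₀) ≤ C * (a₁ + a₀) * ψ ^ n := by
  have : q₁ + q₀ ≤ (a₁ + a₀) * ψ ^ n := by nlinarith
  calc C * (q₁ + q₀) ≤ C * ((a₁ + a₀) * ψ ^ n) := mul_le_mul_of_nonneg_left this hC
    _ = C * (a₁ + a₀) * ψ ^ n := by ring

/-- [arith] [folklore] THE FINE ENVELOPE IS TWO-RATE: raw relative plaquette deviation `p ≤ c_p·φⁿ`, bond deviation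
`0 ≤ ε ≤ c_ε·νⁿ`, base curvature `0 ≤ q ≤ c_q·ψⁿ` give `C·(p + 2·(T·ε)·q) ≤ C·(c_p·φⁿ + 2T·c_ε·c_q·(νψ)ⁿ)`: a `φ`-part
and the CROSS part at the PRODUCT rate `νψ` (transport × curvature). -/
theorem comb_envelope_le (hC : 0 ≤ C) (hT : 0 ≤ T) (hp : p ≤ c_p * φ ^ n) (hε0 : 0 ≤ ε) (hε : ε ≤ c_ε * ν ^ n)
    (hq0 : 0 ≤ q) (hq : q ≤ c_q * ψ ^ n) :
    C * (p + 2 * (T * ε) * q) ≤ C * (c_p * φ ^ n + 2 * T * (c_ε * c_q) * (ν * ψ) ^ n) := by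
  refine mul_le_mul_of_nonneg_left ?_ hC
  have h1 : T * ε * q ≤ T * (c_ε * ν ^ n) * (c_q * ψ ^ n) :=
    mul_le_mul (mul_le_mul_of_nonneg_left hε hT) hq hq0 (mul_nonneg hT (hε0.trans hε))
  rw [mul_pow]
  nlinarith

/-- [arith] [folklore] A two-rate envelope is ONE-rate at any common dominating rate: `φ ≤ ρ`, `μ ≤ ρ` (nonnegative)
give `c₁·φⁿ + c₂·μⁿ ≤ (c₁ + c₂)·ρⁿ` for `c₁, c₂ ≥ 0`. -/
theorem twoRate_le_of_le {c₁ c₂ μ ρ : ℝ} (hc₁ : 0 ≤ c₁) (hc₂ : 0 ≤ c₂) (hφ0 : 0 ≤ φ) (hφρ : φ ≤ ρ) (hμ0 : 0 ≤ μ)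
    (hμρ : μ ≤ ρ) : c₁ * φ ^ n + c₂ * μ ^ n ≤ (c₁ + c₂) * ρ ^ n := by
  have h1 := pow_le_pow_left₀ hφ0 hφρ n
  have h2 := pow_le_pow_left₀ hμ0 hμρ n
  nlinarith

/-- [arith] [folklore] BIRTH-FRAME READING: with the cross part at product rate `νψ ≤ φ` (e.g. `ψ = φ`, `ν ≤ 1`: base
curvature 2-form scaled) the FINE envelope is `φ`-rate with constant `C·(c_p + 2T·c_ε·c_q)`. -/
theorem comb_envelope_perp (hC : 0 ≤ C) (hT : 0 ≤ T) (hp : p ≤ c_p * φ ^ n) (hε0 : 0 ≤ ε) (hε : ε ≤ c_ε * ν ^ n)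
    (hq0 : 0 ≤ q) (hq : q ≤ c_q * ψ ^ n) (hcp : 0 ≤ c_p) (hcε : 0 ≤ c_ε) (hcq : 0 ≤ c_q) (hφ0 : 0 ≤ φ)
    (hν0 : 0 ≤ ν) (hψ0 : 0 ≤ ψ) (hνψ : ν * ψ ≤ φ) :
    C * (p + 2 * (T * ε) * q) ≤ C * (c_p + 2 * T * (c_ε * c_q)) * φ ^ n := by
  have h := comb_envelope_le hC hT hp hε0 hε hq0 hq
  have h2 : c_p * φ ^ n + 2 * T * (c_ε * c_q) * (ν * ψ) ^ n ≤ (c_p + 2 * T * (c_ε * c_q)) * φ ^ n :=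
    twoRate_le_of_le hcp (by positivity) hφ0 le_rfl (mul_nonneg hν0 hψ0) hνψ
  calc _ ≤ _ := h
    _ ≤ C * ((c_p + 2 * T * (c_ε * c_q)) * φ ^ n) := mul_le_mul_of_nonneg_left h2 hC
    _ = _ := by ring

/-- [arith] [folklore] **WHY THE BASE CURVATURE MUST BE READ 2-FORM SCALED** (the dead end of a current-frame reading):
if the cross part sits at a rate `μ` STRICTLY SLOWER than `φ` (`0 < φ < μ`, e.g. `ψ = 1`: base curvature taken
`n`-independent, `μ = ν = L⁻¹ > φ = L⁻²`) with a positive coefficient `κ`, then NO constant makes the two-rate envelope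
`φ`-rate: `(μ/φ)ⁿ` is unbounded. -/
theorem not_eventually_perpRate {μ : ℝ} (hφ : 0 < φ) (hφμ : φ < μ) (hκ : 0 < κ) (hcp : 0 ≤ c_p) :
    ¬ ∃ C' : ℝ, ∀ n : ℕ, c_p * φ ^ n + κ * μ ^ n ≤ C' * φ ^ n := by
  rintro ⟨C', hC'⟩
  have hratio : 1 < μ / φ := (one_lt_div hφ).2 hφμ
  obtain ⟨n, hn⟩ := pow_unbounded_of_one_lt (C' / κ) hratio
  have h1 := hC' n
  have hφn : 0 < φ ^ n := pow_pos hφ n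
  have h2 : κ * μ ^ n ≤ C' * φ ^ n := by nlinarith [mul_nonneg hcp hφn.le]
  have h3 : (μ / φ) ^ n ≤ C' / κ := by
    rw [div_pow, div_le_div_iff₀ hφn hκ]
    nlinarith
  exact absurd hn (not_lt.2 h3)

end Rates

/-! ## §7  Booking level: the curvature-rate hypothesis (I4′) in the seam of `T4BirthChartTransport` §4 -/

section Booking

open T4TermFormat
open T4BirthChartTransport (DefectRate ChartBound BirthSup cubeBudget_of_chart)

variable {B : Booking}

/-- HYPOTHESIS SHAPE (I4′) — CURVATURE RATE in the birth frame: the based-plaquette deviation bound of a configuration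
entering the comparison of the term born at `b`, read at scale `k` on the birth block, is `≤ a·ψ^{k−j}` (`j =
birthScale b`).  Intended reading [cell]: the printed-shape regularity "|U(∂p) − 1| < α₀L^{−2j}" ([Balaban1985RegularSpaces]
(1.7)) of the CURRENT-scale representatives, read on the birth block: `ψ = φ = L⁻²`, `a = α₀ξ_j²`-type.  NOT asserted
for Bałaban's objects here. [folklore] -/
def CurvRate (q : B.Birth → ℕ → ℝ) (a ψ : ℝ) : Prop :=
  ∀ (b : B.Birth) (k : ℕ), B.birthScale b ≤ k → k ≤ B.K → q b k ≤ a * ψ ^ (k - B.birthScale b)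

variable {defect q₀ q₁ p ε q : B.Birth → ℕ → ℝ} {C T a₀ a₁ c_p c_ε c_q φ ν ψ : ℝ}

/-- [folklore] **CRUDE ROUTE ⇒ `DefectRate` AT THE CURVATURE RATE**: the crude comb defect `C·(q₁ + q₀)` with both
curvatures at rate `ψ` is `DefectRate defect (C·(a₁ + a₀)) ψ` — with `ψ = φ` exactly the hypothesis `hDR` of
`T4BirthChartTransport.sizeBound_of_chart` / `cubeBudget_of_chart` (product `Λ·φ·θ₁ = L⁻¹ ≤ 1`, `product_perp_le_one`;
strict regeneration room `product_perp_regen_lt_one_iff`). -/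
theorem defectRate_of_crude (hC : 0 ≤ C) (hdef : ∀ b k, defect b k = C * (q₁ b k + q₀ b k))
    (h₁ : CurvRate q₁ a₁ ψ) (h₀ : CurvRate q₀ a₀ ψ) : DefectRate B defect (C * (a₁ + a₀)) ψ := by
  intro b k hjk hk
  rw [hdef]
  exact crude_envelope_le hC (h₁ b k hjk hk) (h₀ b k hjk hk)

/-- [folklore] FINE ROUTE ⇒ `DefectRate` at rate `φ`, when the cross part's product rate is `νψ ≤ φ`. -/
theorem defectRate_of_comb (hC : 0 ≤ C) (hT : 0 ≤ T)
    (hdef : ∀ b k, defect b k = C * (p b k + 2 * (T * ε b k) * q b k))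
    (hp : ∀ (b : B.Birth) (k : ℕ), B.birthScale b ≤ k → k ≤ B.K → p b k ≤ c_p * φ ^ (k - B.birthScale b))
    (hε0 : ∀ b k, 0 ≤ ε b k)
    (hε : ∀ (b : B.Birth) (k : ℕ), B.birthScale b ≤ k → k ≤ B.K → ε b k ≤ c_ε * ν ^ (k - B.birthScale b))
    (hq0 : ∀ b k, 0 ≤ q b k) (hq : CurvRate q c_q ψ) (hcp : 0 ≤ c_p) (hcε : 0 ≤ c_ε) (hcq : 0 ≤ c_q)
    (hφ0 : 0 ≤ φ) (hν0 : 0 ≤ ν) (hψ0 : 0 ≤ ψ) (hνψ : ν * ψ ≤ φ) :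
    DefectRate B defect (C * (c_p + 2 * T * (c_ε * c_q))) φ := by
  intro b k hjk hk
  rw [hdef]
  exact comb_envelope_perp hC hT (hp b k hjk hk) (hε0 b k) (hε b k hjk hk) (hq0 b k) (hq b k hjk hk) hcp hcε hcq
    hφ0 hν0 hψ0 hνψ

/-- [folklore] **END TO END, BY NAME** (crude route): chart bound + birth sup + two-sided curvature rate `ψ` + positional
count + weights + `Λ·ψ·τ ≤ 1` ⇒ the cube budget `CubeBudget wt ((N₀·(4Â·C(a₁+a₀)/r))·W)` of `T4TermFormat` —
`T4BirthChartTransport.cubeBudget_of_chart` fed by `defectRate_of_crude`.  Every input is a binder. -/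
theorem cubeBudget_of_crude {supB : B.Birth → ℝ} {r Ahat τ : ℝ} {N : ℕ → ℕ → ℝ} {wt : ℕ → ℝ} {N₀ Λ W : ℝ}
    (hw : ∀ j, j ≤ B.K → 0 ≤ wt j) (hW : ∑ j ∈ Finset.range (B.K + 1), wt j ≤ W) (hN : B.PositionalCount N)
    (hNle : ∀ j k, j ≤ k → k ≤ B.K → N j k ≤ N₀ * Λ ^ (k - j)) (hN₀ : 0 ≤ N₀) (hΛ : 0 ≤ Λ)
    (hr : 0 < r) (hAhat : 0 ≤ Ahat) (hC : 0 ≤ C) (ha : 0 ≤ a₁ + a₀) (hψ : 0 ≤ ψ) (hτ : 0 ≤ τ) (hτ1 : τ ≤ 1)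
    (hΛψτ : Λ * ψ * τ ≤ 1) (hdef0 : ∀ b k, 0 ≤ defect b k)
    (hCB : ChartBound B supB r defect) (hBS : BirthSup B supB Ahat τ)
    (hdef : ∀ b k, defect b k = C * (q₁ b k + q₀ b k)) (h₁ : CurvRate q₁ a₁ ψ) (h₀ : CurvRate q₀ a₀ ψ) :
    B.CubeBudget wt ((N₀ * (4 * Ahat * (C * (a₁ + a₀)) / r)) * W) :=
  cubeBudget_of_chart hw hW hN hNle hN₀ hΛ hr hAhat (mul_nonneg hC ha) hψ hτ hτ1 hΛψτ hdef0 hCB hBS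
    (defectRate_of_crude hC hdef h₁ h₀)

end Booking

/-! ## §8  Non-vacuity and the attained commutator -/

section Toy

/-- [folklore] The hypotheses of `block_transport` are jointly satisfiable and the bound is then an equality case `0 ≤ 0`:
the ZERO functional on `ℂ`-valued bond fields of `ℤ^d`, flat pair, `g = 1`, `δ = 0`. -/
example (d L : ℕ) (z : Site d) :
    ‖(fun _ : Fld d ℂ => (0 : ℂ)) (val (fun _ _ => (1 : ℂˣ))) - (fun _ : Fld d ℂ => (0 : ℂ)) (val (fun _ _ => (1 : ℂˣ)))‖
      ≤ 4 * 0 / 1 * 0 := by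
  have hinv : GaugeInvariant (BlockRel L z) (fun _ : Fld d ℂ => (0 : ℂ)) := fun _ _ _ => rfl
  have hsl : BirthSlice (fun _ : Fld d ℂ => (0 : ℂ)) latMove latN (Set.univ : Set (Fld d ℂ)) 1 1 0 := by
    intro U _ p _ _
    exact ⟨Set.univ, differentiableOn_const _, fun _ _ => by simp, fun _ _ => Set.subset_univ _⟩
  exact block_transport (U₀ := fun _ _ => 1) (U₁ := fun _ _ => 1) (g := fun _ => 1) (δ := 0) hinv hsl one_pos
    le_rfl (Set.mem_univ _) (fun _ => UnitaryLike.one) le_rfl zero_le_one fun x ν _ _ => by simp [gaugeAct]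

open Quaternion in
/-- [folklore] THE COMMUTATOR OF §4 IS ATTAINED in a non-commutative unitary-like setting: in the real quaternions (a
normed division ring with `‖1‖ = 1`), `c = i`, `H = j` are unitary-like and `‖c·H·c⁻¹·H⁻¹ − 1‖ = 2` — so the comb
defect of a pure-gauge pair (`defect_pureGauge`) is genuinely non-trivial while the pair's physical size is `0`. -/
example : ∃ c H : (ℍ[ℝ])ˣ, UnitaryLike c ∧ UnitaryLike H ∧ ‖((c * H * c⁻¹ * H⁻¹ : (ℍ[ℝ])ˣ) : ℍ[ℝ]) - 1‖ = 2 := by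
  let qi : ℍ[ℝ] := ⟨0, 1, 0, 0⟩
  let qj : ℍ[ℝ] := ⟨0, 0, 1, 0⟩
  have hii : qi * qi = -1 := by ext <;> simp [qi]
  have hjj : qj * qj = -1 := by ext <;> simp [qj]
  have hij : qi * qj * qi * qj = -1 := by ext <;> simp [qi, qj]
  have hni : ‖qi‖ = 1 := by
    have h := Quaternion.normSq_eq_norm_mul_self qi
    have h1 : Quaternion.normSq qi = 1 := by simp [qi, Quaternion.normSq_def']
    nlinarith [norm_nonneg qi]
  have hnj : ‖qj‖ = 1 := by
    have h := Quaternion.normSq_eq_norm_mul_self qj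
    have h1 : Quaternion.normSq qj = 1 := by simp [qj, Quaternion.normSq_def']
    nlinarith [norm_nonneg qj]
  let c : (ℍ[ℝ])ˣ := ⟨qi, -qi, by rw [mul_neg, hii, neg_neg], by rw [neg_mul, hii, neg_neg]⟩
  let H : (ℍ[ℝ])ˣ := ⟨qj, -qj, by rw [mul_neg, hjj, neg_neg], by rw [neg_mul, hjj, neg_neg]⟩
  refine ⟨c, H, ⟨hni.le, by simpa [c, norm_neg] using hni.le⟩, ⟨hnj.le, by simpa [H, norm_neg] using hnj.le⟩, ?_⟩
  have hw : ((c * H * c⁻¹ * H⁻¹ : (ℍ[ℝ])ˣ) : ℍ[ℝ]) = -1 := by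
    simp only [Units.val_mul, c, H, Units.inv_mk, mul_neg, neg_mul, neg_neg]
    exact hij
  have h2 : ((-1 : ℍ[ℝ]) - 1) = (((-2 : ℝ)) : ℍ[ℝ]) := by
    ext <;> simp
    norm_num
  rw [hw, h2, Quaternion.norm_coe]
  norm_num

end Toy

/-! ## §9  Non-abelian Stokes telescoping on an abstract grid [folklore] -/

section Grid

variable {G : Type*} [Group G]

/-- [folklore] ROW HOLONOMY of grid data: `rowHol H j n = H 0 j · H 1 j ⋯ H (n−1) j` (the ordered product of the
horizontal bond variables of row `j` from column `0` to column `n`). -/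
def rowHol (H : ℕ → ℕ → G) (j : ℕ) : ℕ → G
  | 0 => 1
  | n + 1 => rowHol H j n * H n j

/-- [folklore] COLUMN HOLONOMY: `colHol V i m = V i 0 · V i 1 ⋯ V i (m−1)`. -/
def colHol (V : ℕ → ℕ → G) (i : ℕ) : ℕ → G
  | 0 => 1
  | m + 1 => colHol V i m * V i m

/-- [folklore] The UNIT CELL `(i, j)` based at its lower-left corner: `H i j · V (i+1) j · (H i (j+1))⁻¹ · (V i j)⁻¹`. -/
def cell (H V : ℕ → ℕ → G) (i j : ℕ) : G := H i j * V (i + 1) j * (H i (j + 1))⁻¹ * (V i j)⁻¹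

/-- [folklore] The 1-high STRIP between rows `m`, `m+1` over columns `0 … n`, based at `(0, m)`. -/
def strip (H V : ℕ → ℕ → G) (m n : ℕ) : G := rowHol H m n * V n m * (rowHol H (m + 1) n)⁻¹ * (V 0 m)⁻¹

/-- [folklore] The `n × m` RECTANGLE holonomy based at `(0, 0)`: along row `0` to column `n`, up column `n` to row `m`,
back along row `m`, down column `0`. -/
def rect (H V : ℕ → ℕ → G) (n m : ℕ) : G := rowHol H 0 n * colHol V n m * (rowHol H m n)⁻¹ * (colHol V 0 m)⁻¹

/-- [folklore] -/
@[simp] theorem rowHol_zero (H : ℕ → ℕ → G) (j : ℕ) : rowHol H j 0 = 1 := rfl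

/-- [folklore] -/
theorem rowHol_succ (H : ℕ → ℕ → G) (j n : ℕ) : rowHol H j (n + 1) = rowHol H j n * H n j := rfl

/-- [folklore] -/
@[simp] theorem colHol_zero (V : ℕ → ℕ → G) (i : ℕ) : colHol V i 0 = 1 := rfl

/-- [folklore] -/
theorem colHol_succ (V : ℕ → ℕ → G) (i m : ℕ) : colHol V i (m + 1) = colHol V i m * V i m := rfl

/-- [folklore] -/
@[simp] theorem strip_zero (H V : ℕ → ℕ → G) (m : ℕ) : strip H V m 0 = 1 := by
  simp [strip]

/-- [folklore] HORIZONTAL STOKES STEP (prepend): adding the cell `(n, m)` to the strip multiplies it ON THE LEFT by the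
cell conjugated by the row holonomy to the cell's corner. -/
theorem strip_succ (H V : ℕ → ℕ → G) (m n : ℕ) :
    strip H V m (n + 1) = rowHol H m n * cell H V n m * (rowHol H m n)⁻¹ * strip H V m n := by
  simp only [strip, cell, rowHol_succ]
  group

/-- [folklore] -/
@[simp] theorem rect_zero (H V : ℕ → ℕ → G) (n : ℕ) : rect H V n 0 = 1 := by
  simp [rect]

/-- [folklore] VERTICAL STOKES STEP (append): adding the strip between rows `m`, `m+1` multiplies the rectangle ON THE
RIGHT by the strip conjugated by the column holonomy to the strip's corner. -/
theorem rect_succ (H V : ℕ → ℕ → G) (n m : ℕ) :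
    rect H V n (m + 1) = rect H V n m * (colHol V 0 m * strip H V m n * (colHol V 0 m)⁻¹) := by
  simp only [rect, strip, colHol_succ]
  group

/-- [folklore] The `1 × 1` rectangle is the cell at the origin. -/
theorem rect_one_one (H V : ℕ → ℕ → G) : rect H V 1 1 = cell H V 0 0 := by
  simp [rect, cell, rowHol_succ, colHol_succ]

end Grid

/-! ### The abelian model: the rectangle holonomy is the product of the enclosed cells, exactly -/

section GridAbelian

variable {G : Type*} [CommGroup G]

/-- [folklore] ABELIAN STOKES for strips: `strip m n = ∏_{i<n} cell (i, m)`. -/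
theorem strip_eq_prod (H V : ℕ → ℕ → G) (m : ℕ) : ∀ n, strip H V m n = ∏ i ∈ Finset.range n, cell H V i m
  | 0 => by simp
  | n + 1 => by
    rw [strip_succ, mul_inv_cancel_comm, strip_eq_prod H V m n, Finset.prod_range_succ, mul_comm]

/-- [folklore] ABELIAN STOKES: `rect n m = ∏_{j<m} ∏_{i<n} cell (i, j)` — the exact identity whose non-abelian shadow
is the telescoped BOUND `norm_rect_sub_one_le` below (the additive word model is `B7Prop1Explicit.asum_rectWord`). -/
theorem rect_eq_prod (H V : ℕ → ℕ → G) (n : ℕ) :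
    ∀ m, rect H V n m = ∏ j ∈ Finset.range m, ∏ i ∈ Finset.range n, cell H V i j
  | 0 => by simp
  | m + 1 => by
    rw [rect_succ, mul_inv_cancel_comm, rect_eq_prod H V n m, strip_eq_prod, Finset.prod_range_succ]

end GridAbelian

/-! ### The telescoped bounds for unitary-like grid data -/

section GridNorm

variable [NormOneClass R] {H V : ℕ → ℕ → Rˣ} {α : ℝ}

/-- [folklore] -/
theorem unitaryLike_rowHol (hH : ∀ i j, UnitaryLike (H i j)) (j : ℕ) : ∀ n, UnitaryLike (rowHol H j n)
  | 0 => UnitaryLike.one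
  | n + 1 => (unitaryLike_rowHol hH j n).mul (hH n j)

/-- [folklore] -/
theorem unitaryLike_colHol (hV : ∀ i j, UnitaryLike (V i j)) (i : ℕ) : ∀ m, UnitaryLike (colHol V i m)
  | 0 => UnitaryLike.one
  | m + 1 => (unitaryLike_colHol hV i m).mul (hV i m)

omit [NormOneClass R] in
/-- [folklore] -/
theorem unitaryLike_cell (hH : ∀ i j, UnitaryLike (H i j)) (hV : ∀ i j, UnitaryLike (V i j)) (i j : ℕ) :
    UnitaryLike (cell H V i j) :=
  (((hH i j).mul (hV _ _)).mul (hH _ _).inv).mul (hV i j).inv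

/-- [folklore] -/
theorem unitaryLike_strip (hH : ∀ i j, UnitaryLike (H i j)) (hV : ∀ i j, UnitaryLike (V i j)) (m n : ℕ) :
    UnitaryLike (strip H V m n) :=
  ((((unitaryLike_rowHol hH m n).mul (hV _ _)).mul (unitaryLike_rowHol hH _ n).inv).mul (hV 0 m).inv)

/-- [folklore] -/
theorem unitaryLike_rect (hH : ∀ i j, UnitaryLike (H i j)) (hV : ∀ i j, UnitaryLike (V i j)) (n m : ℕ) :
    UnitaryLike (rect H V n m) :=
  ((((unitaryLike_rowHol hH 0 n).mul (unitaryLike_colHol hV n m)).mul (unitaryLike_rowHol hH m n).inv).mul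
    (unitaryLike_colHol hV 0 m).inv)

/-- [folklore] **STRIP TELESCOPING**: for unitary-like grid data with every cell `(i, m)`, `i < n`, within `α` of `1`,
the strip holonomy is within `n·α` of `1` — conjugation by unitary-like holonomies is an isometry on `· − 1`
(`T4RelativeLadder.norm_conj_sub_one_eq`) and `‖PW − 1‖ ≤ ‖W − 1‖ + ‖P − 1‖` for `‖P‖ ≤ 1`
(`T4AxialChain.norm_mul_sub_one_le_add`). -/
theorem norm_strip_sub_one_le (hH : ∀ i j, UnitaryLike (H i j)) (hV : ∀ i j, UnitaryLike (V i j)) (hα : 0 ≤ α)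
    (m : ℕ) : ∀ n, (∀ i, i < n → ‖((cell H V i m : Rˣ) : R) - 1‖ ≤ α) → ‖((strip H V m n : Rˣ) : R) - 1‖ ≤ n * α
  | 0, _ => by simp
  | n + 1, hcell => by
    have ih := norm_strip_sub_one_le hH hV hα m n fun i hi => hcell i (Nat.lt_succ_of_lt hi)
    have hP1 : ‖((rowHol H m n * cell H V n m * (rowHol H m n)⁻¹ : Rˣ) : R)‖ ≤ 1 :=
      (((unitaryLike_rowHol hH m n).mul (unitaryLike_cell hH hV n m)).mul (unitaryLike_rowHol hH m n).inv).1
    have hPc : ‖((rowHol H m n * cell H V n m * (rowHol H m n)⁻¹ : Rˣ) : R) - 1‖ = ‖((cell H V n m : Rˣ) : R) - 1‖ := by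
      rw [Units.val_mul, Units.val_mul]
      exact norm_conj_sub_one_eq (unitaryLike_rowHol hH m n) _
    rw [strip_succ, Units.val_mul]
    calc _ ≤ ‖((strip H V m n : Rˣ) : R) - 1‖ + ‖((rowHol H m n * cell H V n m * (rowHol H m n)⁻¹ : Rˣ) : R) - 1‖ :=
          T4AxialChain.norm_mul_sub_one_le_add hP1 _
      _ ≤ n * α + α := by rw [hPc]; exact add_le_add ih (hcell n (Nat.lt_succ_self n))
      _ = ((n + 1 : ℕ) : ℝ) * α := by push_cast; ring

/-- [folklore] **NON-ABELIAN STOKES TELESCOPING** (rectangle form): for unitary-like grid data with every cell `(i, j)`,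
`i < n`, `j < m`, within `α` of `1`, the `n × m` rectangle holonomy is within `n·m·α` of `1`.  (The abelian model —
the rectangle sum equals the sum of the enclosed cells exactly — is `B7Prop1Explicit.asum_rectWord`; the `1 × |Q|`
strip case for words is `B7Prop1Explicit.ladder_bound`; neither is imported here.) -/
theorem norm_rect_sub_one_le (hH : ∀ i j, UnitaryLike (H i j)) (hV : ∀ i j, UnitaryLike (V i j)) (hα : 0 ≤ α)
    (n : ℕ) : ∀ m, (∀ i j, i < n → j < m → ‖((cell H V i j : Rˣ) : R) - 1‖ ≤ α) → ‖((rect H V n m : Rˣ) : R) - 1‖ ≤ n * m * α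
  | 0, _ => by simp
  | m + 1, hcell => by
    have ih := norm_rect_sub_one_le hH hV hα n m fun i j hi hj => hcell i j hi (Nat.lt_succ_of_lt hj)
    have hs : ‖((strip H V m n : Rˣ) : R) - 1‖ ≤ n * α :=
      norm_strip_sub_one_le hH hV hα m n fun i hi => hcell i m hi (Nat.lt_succ_self m)
    have hP1 : ‖((colHol V 0 m * strip H V m n * (colHol V 0 m)⁻¹ : Rˣ) : R)‖ ≤ 1 :=
      (((unitaryLike_colHol hV 0 m).mul (unitaryLike_strip hH hV m n)).mul (unitaryLike_colHol hV 0 m).inv).1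
    have hPc : ‖((colHol V 0 m * strip H V m n * (colHol V 0 m)⁻¹ : Rˣ) : R) - 1‖ = ‖((strip H V m n : Rˣ) : R) - 1‖ := by
      rw [Units.val_mul, Units.val_mul]
      exact norm_conj_sub_one_eq (unitaryLike_colHol hV 0 m) _
    rw [rect_succ, Units.val_mul]
    calc _ ≤ ‖((rect H V n m : Rˣ) : R) - 1‖ + ‖((colHol V 0 m * strip H V m n * (colHol V 0 m)⁻¹ : Rˣ) : R) - 1‖ :=
          T4AxialChain.norm_mul_sub_one_le_add' _ hP1
      _ ≤ n * m * α + n * α := by rw [hPc]; exact add_le_add ih hs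
      _ = n * ((m + 1 : ℕ) : ℝ) * α := by push_cast; ring

end GridNorm

/-! ## §10  On the lattice `ℤ^d`: rectangle holonomies, straight segments, BLOCKED configurations -/

section Lattice

/-- [folklore] The horizontal (`μ`-) bond variables of `U` on the grid `x + ℕe_μ + ℕe_ν`. -/
def gridH (U : Cfg d R) (x : Site d) (μ ν : Fin d) : ℕ → ℕ → Rˣ :=
  fun i j => U (x + (i : ℤ) • e μ + (j : ℤ) • e ν) μ

/-- [folklore] The vertical (`ν`-) bond variables of `U` on the grid `x + ℕe_μ + ℕe_ν`. -/
def gridV (U : Cfg d R) (x : Site d) (μ ν : Fin d) : ℕ → ℕ → Rˣ :=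
  fun i j => U (x + (i : ℤ) • e μ + (j : ℤ) • e ν) ν

/-- [folklore] The RECTANGLE HOLONOMY of `U` based at `x`: `n` bonds along `e_μ`, `m` along `e_ν`, back, down. -/
def rectHol (U : Cfg d R) (x : Site d) (μ ν : Fin d) (n m : ℕ) : Rˣ := rect (gridH U x μ ν) (gridV U x μ ν) n m

/-- [folklore] The STRAIGHT-SEGMENT HOLONOMY: `segHol U x μ n = U⟨x,x+e_μ⟩ · U⟨x+e_μ,x+2e_μ⟩ ⋯` (`n` bonds). -/
def segHol (U : Cfg d R) (x : Site d) (μ : Fin d) : ℕ → Rˣ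
  | 0 => 1
  | n + 1 => segHol U x μ n * U (x + (n : ℤ) • e μ) μ

/-- [folklore] -/
@[simp] theorem segHol_zero (U : Cfg d R) (x : Site d) (μ : Fin d) : segHol U x μ 0 = 1 := rfl

/-- [folklore] -/
theorem segHol_succ (U : Cfg d R) (x : Site d) (μ : Fin d) (n : ℕ) :
    segHol U x μ (n + 1) = segHol U x μ n * U (x + (n : ℤ) • e μ) μ := rfl

/-- [folklore] One bond. -/
theorem segHol_one (U : Cfg d R) (x : Site d) (μ : Fin d) : segHol U x μ 1 = U x μ := by
  simp [segHol_succ]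

/-- [folklore] The grid cell `(i, j)` is the based plaquette of `U` at `x + ie_μ + je_ν`. -/
theorem cell_grid (U : Cfg d R) (x : Site d) (μ ν : Fin d) (i j : ℕ) :
    cell (gridH U x μ ν) (gridV U x μ ν) i j = plaq U (x + (i : ℤ) • e μ + (j : ℤ) • e ν) μ ν := by
  have h1 : x + ((i + 1 : ℕ) : ℤ) • e μ + (j : ℤ) • e ν = x + (i : ℤ) • e μ + (j : ℤ) • e ν + e μ := by
    push_cast; rw [add_smul, one_smul]; abel
  have h2 : x + (i : ℤ) • e μ + ((j + 1 : ℕ) : ℤ) • e ν = x + (i : ℤ) • e μ + (j : ℤ) • e ν + e ν := by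
    push_cast; rw [add_smul, one_smul]; abel
  simp only [cell, gridH, gridV, plaq, h1, h2]

/-- [folklore] Rows of the grid are straight segments. -/
theorem rowHol_grid (U : Cfg d R) (x : Site d) (μ ν : Fin d) (j : ℕ) :
    ∀ n, rowHol (gridH U x μ ν) j n = segHol U (x + (j : ℤ) • e ν) μ n
  | 0 => rfl
  | n + 1 => by
    rw [rowHol_succ, segHol_succ, rowHol_grid U x μ ν j n]
    simp only [gridH, add_right_comm x ((n : ℤ) • e μ) ((j : ℤ) • e ν)]

/-- [folklore] Columns of the grid are straight segments. -/
theorem colHol_grid (U : Cfg d R) (x : Site d) (μ ν : Fin d) (i : ℕ) :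
    ∀ m, colHol (gridV U x μ ν) i m = segHol U (x + (i : ℤ) • e μ) ν m
  | 0 => rfl
  | m + 1 => by
    rw [colHol_succ, segHol_succ, colHol_grid U x μ ν i m]
    rfl

/-- [folklore] The rectangle holonomy in terms of its four straight sides. -/
theorem rectHol_eq (U : Cfg d R) (x : Site d) (μ ν : Fin d) (n m : ℕ) :
    rectHol U x μ ν n m = segHol U x μ n * segHol U (x + (n : ℤ) • e μ) ν m *
      (segHol U (x + (m : ℤ) • e ν) μ n)⁻¹ * (segHol U x ν m)⁻¹ := by
  simp only [rectHol, rect, rowHol_grid, colHol_grid, Nat.cast_zero, zero_smul, add_zero]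

/-- [folklore] The `1 × 1` rectangle holonomy is the based plaquette. -/
theorem rectHol_one_one (U : Cfg d R) (x : Site d) (μ ν : Fin d) : rectHol U x μ ν 1 1 = plaq U x μ ν := by
  rw [rectHol, rect_one_one, cell_grid]; simp

/-- [folklore] -/
theorem unitaryLike_segHol [NormOneClass R] {U : Cfg d R} (hU : ∀ x ν, UnitaryLike (U x ν)) (x : Site d)
    (μ : Fin d) : ∀ n, UnitaryLike (segHol U x μ n)
  | 0 => UnitaryLike.one
  | n + 1 => (unitaryLike_segHol hU x μ n).mul (hU _ _)

/-- [folklore] **NON-ABELIAN STOKES ON THE LATTICE**: for a unitary-like configuration whose based plaquettes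
`(x + ie_μ + je_ν; μ, ν)`, `i < n`, `j < m`, are within `α` of `1`, the `n × m` rectangle holonomy based at `x` is
within `n·m·α` of `1`. -/
theorem norm_rectHol_sub_one_le [NormOneClass R] {U : Cfg d R} (hU : ∀ x ν, UnitaryLike (U x ν)) (x : Site d)
    (μ ν : Fin d) {α : ℝ} (hα : 0 ≤ α) (n m : ℕ)
    (hq : ∀ i j : ℕ, i < n → j < m → ‖(plaq U (x + (i : ℤ) • e μ + (j : ℤ) • e ν) μ ν : R) - 1‖ ≤ α) :
    ‖(rectHol U x μ ν n m : R) - 1‖ ≤ n * m * α :=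
  norm_rect_sub_one_le (H := gridH U x μ ν) (V := gridV U x μ ν) (fun _ _ => hU _ _) (fun _ _ => hU _ _) hα n m
    fun i j hi hj => by rw [cell_grid]; exact hq i j hi hj

/-- [folklore] THE BLOCKED CONFIGURATION with blocking factor `N`: the variable of the coarse bond `⟨y, y + e_ν⟩` is the
straight-segment holonomy of `U` over the `N` fine bonds from `N·y` to `N·y + N·e_ν`.  Intended [cell] reading: the
REPRESENTATIVE on the birth (`L^{j}η`-) lattice of a fine (`η`-lattice) configuration when a carried term is read on a
COARSER lattice than the one its argument lives on ("the holonomy of a side-`L^{j}η` plaquette of the fine field");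
NOT Bałaban's averaging `Ū^j` (for which the law below is PRINTED, see `CurvRate`'s docstring). -/
def blockCfg (N : ℕ) (U : Cfg d R) : Cfg d R := fun y ν => segHol U (N • y) ν N

/-- [folklore] -/
theorem blockCfg_apply (N : ℕ) (U : Cfg d R) (y : Site d) (ν : Fin d) : blockCfg N U y ν = segHol U (N • y) ν N := rfl

/-- [folklore] -/
theorem unitaryLike_blockCfg [NormOneClass R] {U : Cfg d R} (hU : ∀ x ν, UnitaryLike (U x ν)) (N : ℕ) (y : Site d)
    (ν : Fin d) : UnitaryLike (blockCfg N U y ν) :=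
  unitaryLike_segHol hU _ _ _

/-- [folklore] Site arithmetic: `N·(y + e_μ) = N·y + N·e_μ`. -/
theorem nsmul_site_add_e (N : ℕ) (y : Site d) (μ : Fin d) : N • (y + e μ) = N • y + (N : ℤ) • e μ := by
  rw [smul_add, natCast_zsmul]

/-- [folklore] THE COARSE PLAQUETTE IS THE FINE `N × N` RECTANGLE: `plaq (blockCfg N U) (y; μ, ν) = rectHol U (N·y) μ ν N N`. -/
theorem plaq_blockCfg (N : ℕ) (U : Cfg d R) (y : Site d) (μ ν : Fin d) :
    plaq (blockCfg N U) y μ ν = rectHol U (N • y) μ ν N N := by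
  simp only [plaq, blockCfg_apply, rectHol_eq, nsmul_site_add_e]

/-- [folklore] **THE DERIVED 2-FORM LAW** (`N²` fine plaquettes per coarse plaquette): if the fine based plaquettes
`(N·y + ie_μ + je_ν; μ, ν)`, `i, j < N`, of a unitary-like `U` are within `α` of `1`, the coarse plaquette of the
blocked configuration at `(y; μ, ν)` is within `N²·α` of `1`.  With the cell's numbers [cell] — fine deviation
`α = α₀η²` at scale `k` ([Balaban1985RegularSpaces] (1.7) innermost / [Balaban1985cUVStability3D] Thm 1 (8)), `N = L^{j}`
fine bonds per birth bond, `η = L^{−k}` — this is `α₀η²L^{2j} = α₀L^{−2(k−j)}`: the law `a·φ^{k−j}`, `φ = L⁻²`, of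
`CurvRate`, DERIVED (unitary telescoping) from the per-plaquette premise, not printed as such (cell GAPS A-t4lit1-1a (ii)). -/
theorem norm_plaq_blockCfg_sub_one_le [NormOneClass R] {U : Cfg d R} (hU : ∀ x ν, UnitaryLike (U x ν)) (N : ℕ)
    (y : Site d) (μ ν : Fin d) {α : ℝ} (hα : 0 ≤ α)
    (hq : ∀ i j : ℕ, i < N → j < N → ‖(plaq U (N • y + (i : ℤ) • e μ + (j : ℤ) • e ν) μ ν : R) - 1‖ ≤ α) :
    ‖(plaq (blockCfg N U) y μ ν : R) - 1‖ ≤ (N : ℝ) ^ 2 * α := by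
  rw [plaq_blockCfg, sq]
  exact norm_rectHol_sub_one_le hU _ μ ν hα N N hq

/-- [folklore] Global form: a uniform fine plaquette bound `α` gives the uniform coarse bound `N²·α`. -/
theorem norm_plaq_blockCfg_sub_one_le' [NormOneClass R] {U : Cfg d R} (hU : ∀ x ν, UnitaryLike (U x ν)) (N : ℕ)
    {μ ν : Fin d} {α : ℝ} (hα : 0 ≤ α) (hq : ∀ x, ‖(plaq U x μ ν : R) - 1‖ ≤ α) (y : Site d) :
    ‖(plaq (blockCfg N U) y μ ν : R) - 1‖ ≤ (N : ℝ) ^ 2 * α :=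
  norm_plaq_blockCfg_sub_one_le hU N y μ ν hα fun _ _ _ _ => hq _

/-- [folklore] … hence the `PlaqSup` input of `block_transport_crude` for the blocked configuration on ANY block. -/
theorem plaqSup_blockCfg [NormOneClass R] {U : Cfg d R} (hU : ∀ x ν, UnitaryLike (U x ν)) (N L : ℕ) (z : Site d)
    {α : ℝ} (hα : 0 ≤ α) (hq : ∀ x (ρ ν : Fin d), ρ ≠ ν → ‖(plaq U x ρ ν : R) - 1‖ ≤ α) :
    PlaqSup L z (fun y ρ ν => ‖(plaq (blockCfg N U) y ρ ν : R) - 1‖) ((N : ℝ) ^ 2 * α) :=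
  fun y ρ ν hρν _ _ _ _ => norm_plaq_blockCfg_sub_one_le' hU N hα (fun x => hq x ρ ν hρν) y

end Lattice

/-! ### The crude transport of BLOCKED pairs: rate = (blocking factor)² × fine curvature -/

section CrudeBlocked

variable [NormedAlgebra ℂ R] {F : Type*} [NormedAddCommGroup F] [NormedSpace ℂ F] [CompleteSpace F]
  {Fn : Fld d R → F} {𝒦 : Set (Fld d R)} {w r A : ℝ} {L : ℕ} {z : Site d}

/-- [folklore] **`block_transport_crude` FOR BLOCKED PAIRS**: two unitary-like FINE configurations with based-plaquette
deviations `≤ α₁`, `≤ α₀` (off-diagonal directions), blocking factor `N`, the blocked base in `𝒦`, and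
`(d−1)(L−1)·N²(α₁ + α₀) ≤ δ ≤ w` ⇒ `‖Fn (blockCfg N U₁) − Fn (blockCfg N U₀)‖ ≤ (4A/r)·δ`.  Every analytic input is a
binder; the only work is `plaqSup_blockCfg`. -/
theorem block_transport_crude_blocked [NormOneClass R] (hinv : GaugeInvariant (BlockRel L z) Fn)
    (hsl : BirthSlice Fn latMove latN 𝒦 w r A) (hr : 0 < r) (hA : 0 ≤ A) (N : ℕ) {U₀ U₁ : Cfg d R}
    (hU₀𝒦 : val (blockCfg N U₀) ∈ 𝒦) (hU₀ : ∀ x ν, UnitaryLike (U₀ x ν)) (hU₁ : ∀ x ν, UnitaryLike (U₁ x ν))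
    {α₀ α₁ δ : ℝ} (hα₀ : 0 ≤ α₀) (hα₁ : 0 ≤ α₁)
    (hq₁ : ∀ x (ρ ν : Fin d), ρ ≠ ν → ‖(plaq U₁ x ρ ν : R) - 1‖ ≤ α₁)
    (hq₀ : ∀ x (ρ ν : Fin d), ρ ≠ ν → ‖(plaq U₀ x ρ ν : R) - 1‖ ≤ α₀)
    (hCδ : ((d : ℝ) - 1) * ((L : ℝ) - 1) * ((N : ℝ) ^ 2 * α₁ + (N : ℝ) ^ 2 * α₀) ≤ δ) (hδ : 0 ≤ δ) (hδw : δ ≤ w) :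
    ‖Fn (val (blockCfg N U₁)) - Fn (val (blockCfg N U₀))‖ ≤ 4 * A / r * δ :=
  block_transport_crude hinv hsl hr hA hU₀𝒦 (fun y ν => unitaryLike_blockCfg hU₀ N y ν)
    (fun y ν => unitaryLike_blockCfg hU₁ N y ν) (plaqSup_blockCfg hU₁ N L z hα₁ hq₁)
    (plaqSup_blockCfg hU₀ N L z hα₀ hq₀) (by positivity) hCδ hδ hδw

end CrudeBlocked

/-! ## §11  Inhabiting `CurvRate` from per-plaquette regularity: the two [arith] seams -/

section CurvSeams

open T4TermFormat

variable {B : Booking} {q : B.Birth → ℕ → ℝ} {a c ψ : ℝ}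

/-- [folklore] [arith] **SAME-LATTICE SEAM.**  If the curvature input of every birth, read at scale `k`, obeys a LEVEL bound
`q b k ≤ a·ψ^k` independent of the birth (intended [cell]: the current configuration's per-plaquette regularity
`ε₀η² = ε₀(L⁻²)^k` in absolute bond-variable units, [Balaban1985cUVStability3D] Thm 1 (8) / [Balaban1985RegularSpaces]
(1.7) innermost, on the birth block's OWN fine plaquettes — the reading of [Balaban1987RG1] (1.6) p. 261, where every
carried term is evaluated at `U_k`), and `0 ≤ ψ ≤ 1`, then `CurvRate q a ψ`. -/
theorem curvRate_of_levelRate (hq : ∀ (b : B.Birth) (k : ℕ), B.birthScale b ≤ k → k ≤ B.K → q b k ≤ a * ψ ^ k)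
    (ha : 0 ≤ a) (hψ0 : 0 ≤ ψ) (hψ1 : ψ ≤ 1) : CurvRate q a ψ := by
  intro b k hjk hk
  have hpow : ψ ^ k ≤ ψ ^ (k - B.birthScale b) := pow_le_pow_of_le_one hψ0 hψ1 (Nat.sub_le k _)
  exact (hq b k hjk hk).trans (mul_le_mul_of_nonneg_left hpow ha)

/-- [folklore] [arith] **BLOCKED SEAM.**  If the curvature input of the birth `b` at scale `k` is the blocked one,
`q b k ≤ N_b²·(c·ψ^k)` (§10 `norm_plaq_blockCfg_sub_one_le` with the level-`k` fine bound `c·ψ^k`), and the blocking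
factors satisfy `N_b²·ψ^{j_b} ≤ 1` (with `ψ = L⁻²`, `N_b = L^{j_b}`: equality, `blocking_budget`), then `CurvRate q c ψ`. -/
theorem curvRate_of_blocked {Nb : B.Birth → ℝ}
    (hq : ∀ (b : B.Birth) (k : ℕ), B.birthScale b ≤ k → k ≤ B.K → q b k ≤ Nb b ^ 2 * (c * ψ ^ k))
    (hN : ∀ b : B.Birth, Nb b ^ 2 * ψ ^ B.birthScale b ≤ 1) (hc : 0 ≤ c) (hψ0 : 0 ≤ ψ) : CurvRate q c ψ := by
  intro b k hjk hk
  obtain ⟨n, rfl⟩ := Nat.exists_eq_add_of_le hjk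
  rw [Nat.add_sub_cancel_left]
  refine (hq b _ hjk hk).trans ?_
  have e : Nb b ^ 2 * (c * ψ ^ (B.birthScale b + n)) = (Nb b ^ 2 * ψ ^ B.birthScale b) * (c * ψ ^ n) := by
    rw [pow_add]; ring
  rw [e]
  exact mul_le_of_le_one_left (mul_nonneg hc (pow_nonneg hψ0 _)) (hN b)

/-- [folklore] [arith] **END TO END FROM LEVEL BOUNDS, BY NAME** (same-lattice seam): `cubeBudget_of_crude` with its two
`CurvRate` binders discharged by `curvRate_of_levelRate` — chart bound + birth sup + LEVEL curvature bounds
`q_i b k ≤ a_i·ψ^k` of both arguments + positional count + weights + `Λ·ψ·τ ≤ 1`, `ψ ≤ 1` ⇒ the cube budget.  Every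
input is a binder; nothing of Bałaban's is asserted. -/
theorem cubeBudget_of_levelRate {defect q₀ q₁ : B.Birth → ℕ → ℝ} {C a₀ a₁ : ℝ} {supB : B.Birth → ℝ} {r Ahat τ : ℝ}
    {N : ℕ → ℕ → ℝ} {wt : ℕ → ℝ} {N₀ Λ W : ℝ}
    (hw : ∀ j, j ≤ B.K → 0 ≤ wt j) (hW : ∑ j ∈ Finset.range (B.K + 1), wt j ≤ W) (hN : B.PositionalCount N)
    (hNle : ∀ j k, j ≤ k → k ≤ B.K → N j k ≤ N₀ * Λ ^ (k - j)) (hN₀ : 0 ≤ N₀) (hΛ : 0 ≤ Λ)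
    (hr : 0 < r) (hAhat : 0 ≤ Ahat) (hC : 0 ≤ C) (ha₁ : 0 ≤ a₁) (ha₀ : 0 ≤ a₀) (hψ : 0 ≤ ψ) (hψ1 : ψ ≤ 1)
    (hτ : 0 ≤ τ) (hτ1 : τ ≤ 1) (hΛψτ : Λ * ψ * τ ≤ 1) (hdef0 : ∀ b k, 0 ≤ defect b k)
    (hCB : T4BirthChartTransport.ChartBound B supB r defect) (hBS : T4BirthChartTransport.BirthSup B supB Ahat τ)
    (hdef : ∀ b k, defect b k = C * (q₁ b k + q₀ b k))
    (h₁ : ∀ (b : B.Birth) (k : ℕ), B.birthScale b ≤ k → k ≤ B.K → q₁ b k ≤ a₁ * ψ ^ k)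
    (h₀ : ∀ (b : B.Birth) (k : ℕ), B.birthScale b ≤ k → k ≤ B.K → q₀ b k ≤ a₀ * ψ ^ k) :
    B.CubeBudget wt ((N₀ * (4 * Ahat * (C * (a₁ + a₀)) / r)) * W) :=
  cubeBudget_of_crude hw hW hN hNle hN₀ hΛ hr hAhat hC (add_nonneg ha₁ ha₀) hψ hτ hτ1 hΛψτ hdef0 hCB hBS hdef
    (curvRate_of_levelRate h₁ ha₁ hψ hψ1) (curvRate_of_levelRate h₀ ha₀ hψ hψ1)

/-- [folklore] [arith] The blocking budget is met with equality by the cell's numbers: `(L^{j})²·(L⁻²)^{j} = 1`. -/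
theorem blocking_budget {L : ℝ} (hL : L ≠ 0) (j : ℕ) : (L ^ j) ^ 2 * (L ^ 2)⁻¹ ^ j = 1 := by
  rw [← pow_mul, inv_pow, ← pow_mul, mul_comm j 2, mul_inv_cancel₀ (pow_ne_zero _ hL)]

end CurvSeams

/-! ## §12  API (XREAD C-pv06g13-2 R1): the block gauge witness as a `RelGauge`, so `ChartBound` is reachable by name -/

section RelGaugeExport

variable [NormedAlgebra ℂ R] {L : ℕ} {z : Site d}

/-- [folklore] **THE `RelGauge` WITNESS OF A BLOCK GAUGE** (the construction inside `block_transport`, exported): a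
unitary-like gauge `g` with `‖(U₁^g − U₀)(b)‖ ≤ δ` on the bonds of `B(z)` and `0 < δ` gives
`RelGauge (BlockRel L z) latMove latN (val U₀) (val U₁) δ` — the per-`(b, k)` input `hsize`'s witness shape of
`T4BirthChartTransport.chartBound_of_response`, whence `ChartBound` (the binder `hCB` of `cubeBudget_of_crude`). -/
theorem relGauge_of_blockGauge {U₀ U₁ : Cfg d R} {g : Site d → Rˣ} (hg : ∀ x, UnitaryLike (g x)) {δ : ℝ}
    (hδ : 0 < δ) (hdef : ∀ x ν, InBlock L z x → InBlock L z (x + e ν) → ‖(gaugeAct g U₁ x ν : R) - U₀ x ν‖ ≤ δ) :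
    RelGauge (BlockRel L z) latMove latN (val U₀) (val U₁) δ := by
  classical
  let D : Fld d R := fun x ν =>
    if InBlock L z x ∧ InBlock L z (x + e ν) then (gaugeAct g U₁ x ν : R) - U₀ x ν else 0
  have hD : ∀ x ν, ‖D x ν‖ ≤ δ := fun x ν => by
    by_cases h : InBlock L z x ∧ InBlock L z (x + e ν)
    · simp only [D, if_pos h]; exact hdef x ν h.1 h.2
    · simp only [D, if_neg h, norm_zero]; exact hδ.le
  refine ⟨⟨(D, δ), hD⟩, hδ, le_rfl, g, hg, fun x ν hx hxν => ?_⟩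
  rw [latMove_one_apply, val_apply]
  show (U₀ x ν : R) + D x ν = _
  simp only [D, if_pos (And.intro hx hxν), gaugeAct, Units.val_mul, val_apply]
  abel

/-- [folklore] The comb-gauge instance: under the hypotheses of `block_transport_crude` with `0 < δ`, the pair
`(U₀, U₁)` is `RelGauge`-related at window `δ` (witness: the relative comb gauge of `T4RelativeComb`). -/
theorem relGauge_crude [NormOneClass R] {U₀ U₁ : Cfg d R} (hU₀ : ∀ x ν, UnitaryLike (U₀ x ν))
    (hU₁ : ∀ x ν, UnitaryLike (U₁ x ν)) {q₀ q₁ δ : ℝ}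
    (hq₁ : PlaqSup L z (fun y ρ ν => ‖(plaq U₁ y ρ ν : R) - 1‖) q₁)
    (hq₀ : PlaqSup L z (fun y ρ ν => ‖(plaq U₀ y ρ ν : R) - 1‖) q₀) (hq : 0 ≤ q₁ + q₀)
    (hCδ : ((d : ℝ) - 1) * ((L : ℝ) - 1) * (q₁ + q₀) ≤ δ) (hδ : 0 < δ) :
    RelGauge (BlockRel L z) latMove latN (val U₀) (val U₁) δ := by
  refine relGauge_of_blockGauge (T4RelativeComb.unitaryLike_combGauge hU₀ hU₁ z) hδ fun x ν hx hxν => ?_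
  have hW := T4RelativeComb.interior_bound_crude hU₀ hU₁ hq₁ hq₀ hq x ν hx hxν
  rw [T4RelativeComb.defect] at hW
  have e1 : (gaugeAct (T4RelativeComb.combGauge U₀ U₁ z) U₁ x ν : R) - U₀ x ν =
      ((((gaugeAct (T4RelativeComb.combGauge U₀ U₁ z) U₁ x ν * (U₀ x ν)⁻¹ : Rˣ)) : R) - 1) * (U₀ x ν : R) := by
    rw [sub_mul, one_mul, Units.val_mul, Units.inv_mul_cancel_right]
  rw [e1]
  calc _ ≤ ‖(((gaugeAct (T4RelativeComb.combGauge U₀ U₁ z) U₁ x ν * (U₀ x ν)⁻¹ : Rˣ)) : R) - 1‖ * ‖(U₀ x ν : R)‖ :=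
        norm_mul_le _ _
    _ ≤ ((d : ℝ) - 1) * ((L : ℝ) - 1) * (q₁ + q₀) * 1 :=
        mul_le_mul hW (hU₀ x ν).1 (norm_nonneg _) (le_trans (norm_nonneg _) hW)
    _ ≤ δ := by rw [mul_one]; exact hCδ

end RelGaugeExport

/-! ## §13  Non-vacuity and sharpness of the telescoped constant -/

section Toy2

/-- [folklore] Non-vacuity of §9 on concrete data: the flat grid (`R = ℂ`, all bond variables `1`) has every
rectangle holonomy equal to `1` (so `norm_rect_sub_one_le` holds with `α = 0` non-vacuously); first-order SHARPNESS of
the constant `n·m` is the abelian identity `rect_eq_prod` (all cells equal to `u` ⇒ `rect n m = u^{nm}`). -/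
example (n m : ℕ) : rect (fun _ _ => (1 : ℂˣ)) (fun _ _ => (1 : ℂˣ)) n m = 1 := by
  have hr : ∀ j k, rowHol (fun _ _ => (1 : ℂˣ)) j k = 1 := fun j k => by
    induction k with
    | zero => rfl
    | succ k ih => rw [rowHol_succ, ih, one_mul]
  have hc : ∀ i k, colHol (fun _ _ => (1 : ℂˣ)) i k = 1 := fun i k => by
    induction k with
    | zero => rfl
    | succ k ih => rw [colHol_succ, ih, one_mul]
  simp [rect, hr, hc]

end Toy2

/-! ## §14  K-UNIFORMITY FROM THE STRICT PRODUCT [arith]: bounded weights suffice when `Λ·ψ·τ ≤ ρ < 1`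

`T4TubeBudget.tubeBudget_of_rate` / `T4BirthChartTransport.cubeBudget_of_chart` / `cubeBudget_of_crude` bound the
count-times-size product `(Λψτ)^{k−j}·τ^{K−k}` by `1` and pay for the sum over birth scales `j ≤ k` with the TOTAL of
the weights, `W ≥ Σ_{j ≤ K} wt j` — K-uniform only for weights dominated by a summable profile
(`T4TubeBudget.tubeBudget_uniform`; printed model [Balaban1988Convergent] p. 260 *"The sum over j is controlled by
g_j^{κ_0}."*, cell V5 (iv) "given Σ_j g_j^{κ₀+2} R_j² < ∞").  For the first-order sizes booked through the birth chart
the product is STRICT — the cell's numbers give `Λ·φ·θ₁ = L⁴·L⁻²·L⁻³ = L⁻¹` (`T4BirthChartTransport.product_perp`) —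
and then the sum over `j` is a GEOMETRIC series in `k − j`: the budget holds with the constant `A·w̄/(1 − ρ)` for merely
BOUNDED weights `wt j ≤ w̄`, uniformly in `K`, with no summability of the coupling weights.  The room `1 − ρ` is the
same room the regeneration constant of the ℝ-steps consumes (`T4BirthChartTransport.product_perp_regen_lt_one_iff`,
cell O-G2): `ρ = Λψτ·(1 + regeneration)` is the honest parameter.  Arithmetic only; which weights and which `ρ` the
cell's booking has is NOT asserted here. -/

section StrictRate

open Finset

/-- [folklore] [arith] The geometric tail: `Σ_{j ≤ k} ρ^{k−j} ≤ (1 − ρ)⁻¹` for `0 ≤ ρ < 1`. -/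
theorem sum_pow_sub_le_inv {ρ : ℝ} (hρ0 : 0 ≤ ρ) (hρ1 : ρ < 1) (k : ℕ) :
    ∑ j ∈ range (k + 1), ρ ^ (k - j) ≤ (1 - ρ)⁻¹ := by
  have hrefl : ∑ j ∈ range (k + 1), ρ ^ (k - j) = ∑ i ∈ range (k + 1), ρ ^ i := by
    rw [← Finset.sum_range_reflect (fun i => ρ ^ i) (k + 1)]
    exact sum_congr rfl fun j _ => by simp
  rw [hrefl, ← tsum_geometric_of_lt_one hρ0 hρ1]
  exact (summable_geometric_of_lt_one hρ0 hρ1).sum_le_tsum _ fun i _ => pow_nonneg hρ0 i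

/-- [folklore] [arith] **TUBE LEVEL, STRICT RATE**: sizes `s j k ≤ A·ρ^{k−j}` with `0 ≤ ρ < 1`, `A ≥ 0`, and weights
`0 ≤ w j ≤ w̄` give `TubeBudget K w s (A·w̄·(1 − ρ)⁻¹)` — a constant independent of `K` and of any sum of weights
(compare `T4TubeBudget.tubeBudget_of_rate`: constant `A·W`, `W` = total weight). -/
theorem tubeBudget_of_strictRate {K : ℕ} {w : ℕ → ℝ} {s : ℕ → ℕ → ℝ} {A ρ wbar : ℝ}
    (hw : ∀ j ≤ K, 0 ≤ w j) (hwb : ∀ j ≤ K, w j ≤ wbar) (hA : 0 ≤ A) (hρ0 : 0 ≤ ρ) (hρ1 : ρ < 1)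
    (hs : ∀ k ≤ K, ∀ j ≤ k, s j k ≤ A * ρ ^ (k - j)) :
    T4TubeBudget.TubeBudget K w s (A * wbar * (1 - ρ)⁻¹) := by
  intro k hk
  have hwbar : 0 ≤ wbar := (hw 0 (Nat.zero_le _)).trans (hwb 0 (Nat.zero_le _))
  calc ∑ j ∈ range (k + 1), w j * s j k ≤ ∑ j ∈ range (k + 1), wbar * (A * ρ ^ (k - j)) := by
        refine sum_le_sum fun j hj => ?_
        have hjk : j ≤ k := Nat.lt_succ_iff.mp (mem_range.mp hj)
        exact (mul_le_mul_of_nonneg_left (hs k hk j hjk) (hw j (hjk.trans hk))).trans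
          (mul_le_mul_of_nonneg_right (hwb j (hjk.trans hk)) (mul_nonneg hA (pow_nonneg hρ0 _)))
    _ = A * wbar * ∑ j ∈ range (k + 1), ρ ^ (k - j) := by
        rw [mul_sum]; exact sum_congr rfl fun j _ => by ring
    _ ≤ A * wbar * (1 - ρ)⁻¹ := mul_le_mul_of_nonneg_left (sum_pow_sub_le_inv hρ0 hρ1 k) (mul_nonneg hA hwbar)

/-- [folklore] [arith] The count-times-rates split under `j ≤ k ≤ K`: `Λ^{k−j}·ψ^{k−j}·τ^{K−j} ≤ ρ^{k−j}` when
`Λψτ ≤ ρ`, `0 ≤ Λ, ψ, τ`, `τ ≤ 1` (the factor `τ^{K−k} ≤ 1` is discarded). -/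
theorem count_mul_twoRate_le_pow {Λ ψ τ ρ : ℝ} (hΛ : 0 ≤ Λ) (hψ : 0 ≤ ψ) (hτ0 : 0 ≤ τ) (hτ1 : τ ≤ 1)
    (hρ : Λ * ψ * τ ≤ ρ) {j k K : ℕ} (hjk : j ≤ k) (hkK : k ≤ K) :
    Λ ^ (k - j) * ψ ^ (k - j) * τ ^ (K - j) ≤ ρ ^ (k - j) := by
  have e : K - j = (k - j) + (K - k) := by omega
  have h0 : 0 ≤ Λ * ψ * τ := mul_nonneg (mul_nonneg hΛ hψ) hτ0
  calc Λ ^ (k - j) * ψ ^ (k - j) * τ ^ (K - j) = (Λ * ψ * τ) ^ (k - j) * τ ^ (K - k) := by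
        rw [e, pow_add, mul_pow, mul_pow]; ring
    _ ≤ ρ ^ (k - j) * 1 :=
        mul_le_mul (pow_le_pow_left₀ h0 hρ _) (pow_le_one₀ hτ0 hτ1) (pow_nonneg hτ0 _)
          (pow_nonneg (h0.trans hρ) _)
    _ = ρ ^ (k - j) := mul_one _

/-- [folklore] [arith] **TUBE LEVEL, TWO-RATE SHAPE, STRICT**: sizes `s j k ≤ A·Λ^{k−j}·ψ^{k−j}·τ^{K−j}` (count ×
birth-distance gain × final-distance decay) with `Λψτ ≤ ρ < 1`, `τ ≤ 1`, and bounded weights `0 ≤ w j ≤ w̄` give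
`TubeBudget K w s (A·w̄·(1 − ρ)⁻¹)` — the K-uniform companion of `T4TubeBudget.tubeBudget_of_rate` for the consumers of
`T4TubeBudget` (row O3b.B) by name. -/
theorem tubeBudget_of_twoRate_strict {K : ℕ} {w : ℕ → ℝ} {s : ℕ → ℕ → ℝ} {A Λ ψ τ ρ wbar : ℝ}
    (hw : ∀ j ≤ K, 0 ≤ w j) (hwb : ∀ j ≤ K, w j ≤ wbar) (hA : 0 ≤ A) (hΛ : 0 ≤ Λ) (hψ : 0 ≤ ψ) (hτ0 : 0 ≤ τ)
    (hτ1 : τ ≤ 1) (hρ : Λ * ψ * τ ≤ ρ) (hρ1 : ρ < 1)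
    (hs : ∀ k ≤ K, ∀ j ≤ k, s j k ≤ A * Λ ^ (k - j) * ψ ^ (k - j) * τ ^ (K - j)) :
    T4TubeBudget.TubeBudget K w s (A * wbar * (1 - ρ)⁻¹) := by
  have hρ0 : 0 ≤ ρ := (mul_nonneg (mul_nonneg hΛ hψ) hτ0).trans hρ
  refine tubeBudget_of_strictRate hw hwb hA hρ0 hρ1 fun k hk j hjk => (hs k hk j hjk).trans ?_
  calc A * Λ ^ (k - j) * ψ ^ (k - j) * τ ^ (K - j) = A * (Λ ^ (k - j) * ψ ^ (k - j) * τ ^ (K - j)) := by ring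
    _ ≤ A * ρ ^ (k - j) := mul_le_mul_of_nonneg_left (count_mul_twoRate_le_pow hΛ hψ hτ0 hτ1 hρ hjk hk) hA

end StrictRate

section StrictBooking

open Finset T4TermFormat
open T4BirthChartTransport (DefectRate ChartBound BirthSup sizeBound_of_chart)

variable {B : Booking}

/-- [folklore] [arith] **THE K-UNIFORM CUBE BUDGET FROM THE CHART, STRICT PRODUCT**: chart bound + birth sup (rate `τ`)
+ defect rate (`ψ`) + positional count `N j k ≤ N₀·Λ^{k−j}` + `Λψτ ≤ ρ < 1` + BOUNDED nonnegative weights `wt j ≤ w̄`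
⇒ `CubeBudget wt ((N₀·(4Âc/r))·w̄·(1 − ρ)⁻¹)` — no total of weights, hence uniform in `K`
(`T4BirthChartTransport.cubeBudget_of_chart` is the `Λψτ ≤ 1`, total-weight version).  By
`T4TermFormat.Booking.cubeBudget_of_tubeBudget` + `sizeBound_of_chart` + `tubeBudget_of_strictRate`. -/
theorem cubeBudget_of_chart_strict {supB : B.Birth → ℝ} {defect : B.Birth → ℕ → ℝ} {r Ahat c ψ τ ρ : ℝ}
    {N : ℕ → ℕ → ℝ} {wt : ℕ → ℝ} {N₀ Λ wbar : ℝ}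
    (hw : ∀ j, j ≤ B.K → 0 ≤ wt j) (hwb : ∀ j, j ≤ B.K → wt j ≤ wbar) (hN : B.PositionalCount N)
    (hNle : ∀ j k, j ≤ k → k ≤ B.K → N j k ≤ N₀ * Λ ^ (k - j)) (hN₀ : 0 ≤ N₀) (hΛ : 0 ≤ Λ)
    (hr : 0 < r) (hAhat : 0 ≤ Ahat) (hc : 0 ≤ c) (hψ : 0 ≤ ψ) (hτ : 0 ≤ τ) (hτ1 : τ ≤ 1)
    (hρ : Λ * ψ * τ ≤ ρ) (hρ0 : 0 ≤ ρ) (hρ1 : ρ < 1) (hdef0 : ∀ b k, 0 ≤ defect b k)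
    (hCB : ChartBound B supB r defect) (hBS : BirthSup B supB Ahat τ) (hDR : DefectRate B defect c ψ) :
    B.CubeBudget wt ((N₀ * (4 * Ahat * c / r)) * wbar * (1 - ρ)⁻¹) := by
  refine Booking.cubeBudget_of_tubeBudget hw hN (sizeBound_of_chart hr hAhat hτ hdef0 hCB hBS hDR)
    (fun j k => by positivity) ?_
  refine tubeBudget_of_strictRate hw hwb (by positivity) hρ0 hρ1 ?_
  intro k hk j hjk
  calc N j k * (4 * Ahat * c / r * ψ ^ (k - j) * τ ^ (B.K - j))
      ≤ (N₀ * Λ ^ (k - j)) * (4 * Ahat * c / r * ψ ^ (k - j) * τ ^ (B.K - j)) :=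
        mul_le_mul_of_nonneg_right (hNle j k hjk hk) (by positivity)
    _ = N₀ * (4 * Ahat * c / r) * (Λ ^ (k - j) * ψ ^ (k - j) * τ ^ (B.K - j)) := by ring
    _ ≤ N₀ * (4 * Ahat * c / r) * ρ ^ (k - j) :=
        mul_le_mul_of_nonneg_left (count_mul_twoRate_le_pow hΛ hψ hτ hτ1 hρ hjk hk) (by positivity)

variable {q₀ q₁ : B.Birth → ℕ → ℝ} {C a₀ a₁ : ℝ}

/-- [folklore] [arith] **END TO END, STRICT** (crude route, level bounds in): as `cubeBudget_of_levelRate` but with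
`Λψτ ≤ ρ < 1` and BOUNDED weights `wt j ≤ w̄` — the cube budget `((N₀·(4Â·C(a₁+a₀)/r))·w̄·(1 − ρ)⁻¹)`, uniform in `K`.
With the cell's numbers `ρ = L⁻¹` (`T4BirthChartTransport.product_perp`), `(1 − ρ)⁻¹ = L/(L − 1)`. -/
theorem cubeBudget_of_levelRate_strict {defect : B.Birth → ℕ → ℝ} {supB : B.Birth → ℝ} {r Ahat τ ψ ρ : ℝ}
    {N : ℕ → ℕ → ℝ} {wt : ℕ → ℝ} {N₀ Λ wbar : ℝ}
    (hw : ∀ j, j ≤ B.K → 0 ≤ wt j) (hwb : ∀ j, j ≤ B.K → wt j ≤ wbar) (hN : B.PositionalCount N)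
    (hNle : ∀ j k, j ≤ k → k ≤ B.K → N j k ≤ N₀ * Λ ^ (k - j)) (hN₀ : 0 ≤ N₀) (hΛ : 0 ≤ Λ)
    (hr : 0 < r) (hAhat : 0 ≤ Ahat) (hC : 0 ≤ C) (ha₁ : 0 ≤ a₁) (ha₀ : 0 ≤ a₀) (hψ : 0 ≤ ψ) (hψ1 : ψ ≤ 1)
    (hτ : 0 ≤ τ) (hτ1 : τ ≤ 1) (hρ : Λ * ψ * τ ≤ ρ) (hρ0 : 0 ≤ ρ) (hρ1 : ρ < 1) (hdef0 : ∀ b k, 0 ≤ defect b k)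
    (hCB : ChartBound B supB r defect) (hBS : BirthSup B supB Ahat τ)
    (hdef : ∀ b k, defect b k = C * (q₁ b k + q₀ b k))
    (h₁ : ∀ (b : B.Birth) (k : ℕ), B.birthScale b ≤ k → k ≤ B.K → q₁ b k ≤ a₁ * ψ ^ k)
    (h₀ : ∀ (b : B.Birth) (k : ℕ), B.birthScale b ≤ k → k ≤ B.K → q₀ b k ≤ a₀ * ψ ^ k) :
    B.CubeBudget wt ((N₀ * (4 * Ahat * (C * (a₁ + a₀)) / r)) * wbar * (1 - ρ)⁻¹) :=
  cubeBudget_of_chart_strict hw hwb hN hNle hN₀ hΛ hr hAhat (mul_nonneg hC (add_nonneg ha₁ ha₀)) hψ hτ hτ1 hρ hρ0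
    hρ1 hdef0 hCB hBS
    (defectRate_of_crude hC hdef (curvRate_of_levelRate h₁ ha₁ hψ hψ1) (curvRate_of_levelRate h₀ ha₀ hψ hψ1))

/-- [folklore] [arith] The cell's numbers make the product STRICT with room `1 − L⁻¹`:
`L⁴·(L²)⁻¹·(L⁻¹)³ = L⁻¹ < 1` for `1 < L`, and `(1 − L⁻¹)⁻¹ = L/(L − 1)`. -/
theorem strict_room {L : ℝ} (hL : 1 < L) :
    L ^ 4 * (L ^ 2)⁻¹ * L⁻¹ ^ 3 < 1 ∧ (1 - L⁻¹)⁻¹ = L / (L - 1) := by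
  have hL0 : L ≠ 0 := by positivity
  have hL1 : L - 1 ≠ 0 := sub_ne_zero.mpr (ne_of_gt hL)
  refine ⟨?_, ?_⟩
  · rw [T4BirthChartTransport.product_perp hL0]
    exact inv_lt_one_of_one_lt₀ hL
  · field_simp

end StrictBooking

/-! ## §15  THE COMPLEX WINDOW (v1.3): block transport for NEAR-UNITARY pairs under a (1.19)-type invariance

PRINTED COUNTERPART (CONTEXT ONLY; quoted from the render of B12 p.263, read as an image by this seat).  «Symmetries
are the subject of this point in our discussion of properties of the actions. The most important is gauge invariance.
We assume that all functions E^{(j)}(X, g_{j−1}, U, J) are gauge invariant with respect to the group of all gauge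
transformations (1.10). Explicitly  E^{(j)}(X, g_{j−1}, U^u, R(u)J) = E^{(j)}(X, g_{j−1}, U, J)  (1.19)  for all
Gᶜ-valued gauge transformations u. The spaces Uᶜ_j(X, α₀, α₁) are, by the definition, gauge invariant also. This
assumption is an easily verifiable statement for all explicitly defined terms in the action (1.3).»

TYPED COUNTERPART.  `BlockRelP P L z U V`: `V` is, on the interior bonds of `B(z)`, the gauge transform of `U` by some
`g : ℤ^d → Rˣ` whose values AT THE SITES OF `B(z)` satisfy the predicate `P : Rˣ → Prop` (values off the block never
enter).  `P = UnitaryLike` is §2's `BlockRel` (up to the irrelevant off-block values, `blockRelP_of_blockRel`);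
`P = NearUnitary K'` (pv04-g14's `T4RelativeCombWindow.NearUnitary`: `‖u‖ ≤ K'`, `‖u⁻¹‖ ≤ K'`) is the COMPLEX WINDOW;
`P = ⊤` is "all invertible".  `GaugeInvariant (BlockRelP P L z) Fn` is the (1.19)-TYPE HYPOTHESIS: printed (as (1.19),
with `u` Gᶜ-valued) for Bałaban's E-terms, a CELL hypothesis for the observable-attached D-terms; `Rˣ` may be larger
than the image of `Gᶜ`, so the instantiating seat chooses `P` — nothing printed is asserted here.  WHAT §15 PROVES
[folklore]: the block transport theorem VERBATIM for `P`-valued block gauges (`block_transport_P`; §3's proof never used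
unitarity of `g` except to witness the relation), its `RelGauge` export (`relGauge_of_blockGaugeP`), and THE WINDOW
INSTANCE `block_transport_window` / `relGauge_window`: for `K ≥ 1` and `K`-near-unitary `U₀, U₁` with plaquette sups
`q₁, q₀` on `B(z)`, the relative comb gauge is `G²`-near-unitary on the block (`G = blockGaugeConst K d L =
K^{d(L−1)}`, pv04-g14 `nearUnitary_combGauge_block`) and the interior bond deviation after it is at most
`K · windowCost K d L · (d−1)(L−1) · (q₁ + q₀)` (pv04-g14 `interior_bound_window`, times `‖U₀⟨b⟩‖ ≤ K`), whence
`‖Fn U₁ − Fn U₀‖ ≤ (4A/r)·δ` for any `δ` in the window dominating it — the transport-level half of the carved residual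
OG1′-RESID° (i) for UNFACTORISED near-unitary pairs; at `K = 1` it is `block_transport_crude` (`windowCost 1 d L = 1`).
SCOPE NOTE (pv04-g14 journal NOTE 2026-08-19T09:03:59Z and GAPS A-t4lit1-3 and A-t4lit1-3a, records of other seats, quoted for
coordination only): the PRINTED presentation of complex configurations is FACTORISED (B12 (1.10)–(1.15) p.262: `𝐔 = U′U`,
gauge transformations acting on the G-valued part, the complex factor carried with LINEAR bounds); for pairs presented
that way the comb gauge of the UNITARY parts is unitary-like and §3's `block_transport` applies as it stands, with
G-valued invariance only (pv04-g14's `T4RelativeCombWindow` §7, in preparation, types the linear factorised bound);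
§15 is the route for pairs given only as near-unitary units, and `BlockRelP` is the common generalisation either route
can quote. -/

section Window

open T4RelativeCombWindow (NearUnitary blockGaugeConst windowCost nearUnitary_combGauge_block interior_bound_window
  one_le_blockGaugeConst one_le_windowCost windowCost_one)

/-- [folklore] THE `P`-VALUED BLOCK GAUGE RELATION (see the §15 header): agreement on the interior bonds of `B(z)` up to
a gauge transformation whose values on the sites of `B(z)` satisfy `P`. -/
def BlockRelP (P : Rˣ → Prop) (L : ℕ) (z : Site d) (U V : Fld d R) : Prop :=
  ∃ g : Site d → Rˣ, (∀ x, InBlock L z x → P (g x)) ∧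
    ∀ x ν, InBlock L z x → InBlock L z (x + e ν) → V x ν = (g x : R) * U x ν * (((g (x + e ν))⁻¹ : Rˣ) : R)

/-- [folklore] `BlockRel` is `BlockRelP P` for any `P` containing the unitary-like units. -/
theorem blockRelP_of_blockRel {P : Rˣ → Prop} (hP : ∀ u : Rˣ, UnitaryLike u → P u) {U V : Fld d R}
    (h : BlockRel L z U V) : BlockRelP P L z U V := by
  obtain ⟨g, hg, hUV⟩ := h
  exact ⟨g, fun x _ => hP _ (hg x), hUV⟩

/-- [folklore] Monotonicity in the predicate. -/
theorem blockRelP_mono {P Q : Rˣ → Prop} (hPQ : ∀ u, P u → Q u) {U V : Fld d R} (h : BlockRelP P L z U V) :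
    BlockRelP Q L z U V := by
  obtain ⟨g, hg, hUV⟩ := h
  exact ⟨g, fun x hx => hPQ _ (hg x hx), hUV⟩

/-- [folklore] A `P`-valued-on-the-block gauge transform is `BlockRelP P`-related to the original. -/
theorem blockRelP_gaugeAct {P : Rˣ → Prop} {g : Site d → Rˣ} (hg : ∀ x, InBlock L z x → P (g x)) (U : Cfg d R) :
    BlockRelP P L z (val U) (val (gaugeAct g U)) :=
  ⟨g, hg, fun x ν _ _ => by simp [gaugeAct]⟩

/-- [folklore] Conversely, a `BlockRelP UnitaryLike` witness becomes a `BlockRel` witness by resetting the (irrelevant)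
off-block values of the gauge to `1` — so `BlockRel L z = BlockRelP UnitaryLike L z` as relations, and at `K' = 1`
(`T4RelativeCombWindow.NearUnitary.iff_unitaryLike`) the window relation IS §2's relation. -/
theorem blockRel_of_blockRelP [NormOneClass R] {U V : Fld d R} (h : BlockRelP (fun u : Rˣ => UnitaryLike u) L z U V) :
    BlockRel L z U V := by
  classical
  obtain ⟨g, hg, hUV⟩ := h
  refine ⟨fun x => if InBlock L z x then g x else 1, fun x => ?_, fun x ν hx hxν => ?_⟩
  · by_cases hx : InBlock L z x
    · simp only [if_pos hx]; exact hg x hx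
    · simp only [if_neg hx]; exact UnitaryLike.one
  · simp only [if_pos hx, if_pos hxν]; exact hUV x ν hx hxν

/-- [folklore] `BlockRel L z U V ↔ BlockRelP UnitaryLike L z U V`. -/
theorem blockRel_iff_blockRelP [NormOneClass R] {U V : Fld d R} :
    BlockRel L z U V ↔ BlockRelP (fun u : Rˣ => UnitaryLike u) L z U V :=
  ⟨blockRelP_of_blockRel fun _ h => h, blockRel_of_blockRelP⟩

/-- [folklore] The window predicate at `K' = 1` is the unitary-like predicate. -/
theorem nearUnitary_one_eq : (NearUnitary (R := R) 1) = fun u : Rˣ => UnitaryLike u :=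
  funext fun u => propext (T4RelativeCombWindow.NearUnitary.iff_unitaryLike u)

/-- [folklore] Invariance under the LARGER relation `BlockRelP P` (any `P ⊇ UnitaryLike`) implies invariance under
§2's `BlockRel` — so every §3–§12 statement applies to a (1.19)-type invariant `Fn`. -/
theorem gaugeInvariant_blockRel_of_blockRelP {F : Type*} {Fn : Fld d R → F} {P : Rˣ → Prop} (hP : ∀ u : Rˣ, UnitaryLike u → P u)
    (hinv : GaugeInvariant (BlockRelP P L z) Fn) : GaugeInvariant (BlockRel L z) Fn :=
  fun U V h => hinv U V (blockRelP_of_blockRel hP h)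

/-- [folklore] THE WINDOW BOND BOUND: for `K ≥ 1` and `K`-near-unitary `U₀, U₁` with plaquette sups `q₁, q₀` on `B(z)`,
the interior bond deviation after the relative comb gauge is at most `K · windowCost K d L · (d−1)(L−1) · (q₁ + q₀)`
(pv04-g14 `interior_bound_window` BY NAME, times `‖U₀⟨b⟩‖ ≤ K`). -/
theorem window_bond_bound [NormOneClass R] {K : ℝ} (hK : 1 ≤ K) {U₀ U₁ : Cfg d R}
    (hU₀ : ∀ x ν, NearUnitary K (U₀ x ν)) (hU₁ : ∀ x ν, NearUnitary K (U₁ x ν)) {q₀ q₁ : ℝ}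
    (hq₁ : PlaqSup L z (fun y ρ ν => ‖(plaq U₁ y ρ ν : R) - 1‖) q₁)
    (hq₀ : PlaqSup L z (fun y ρ ν => ‖(plaq U₀ y ρ ν : R) - 1‖) q₀) (hq₁0 : 0 ≤ q₁) (hq₀0 : 0 ≤ q₀)
    (x : Site d) (ν : Fin d) (hx : InBlock L z x) (hxν : InBlock L z (x + e ν)) :
    ‖(gaugeAct (combGauge U₀ U₁ z) U₁ x ν : R) - U₀ x ν‖
      ≤ K * (windowCost K d L * (((d : ℝ) - 1) * ((L : ℝ) - 1)) * (q₁ + q₀)) := by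
  have hW := interior_bound_window hK hU₀ hU₁ hq₁ hq₀ hq₁0 hq₀0 x ν hx hxν
  rw [T4RelativeComb.defect] at hW
  have hW0 : 0 ≤ windowCost K d L * (((d : ℝ) - 1) * ((L : ℝ) - 1)) * (q₁ + q₀) := (norm_nonneg _).trans hW
  have e1 : (gaugeAct (combGauge U₀ U₁ z) U₁ x ν : R) - U₀ x ν =
      ((((gaugeAct (combGauge U₀ U₁ z) U₁ x ν * (U₀ x ν)⁻¹ : Rˣ)) : R) - 1) * (U₀ x ν : R) := by
    rw [sub_mul, one_mul, Units.val_mul, Units.inv_mul_cancel_right]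
  rw [e1]
  calc _ ≤ ‖(((gaugeAct (combGauge U₀ U₁ z) U₁ x ν * (U₀ x ν)⁻¹ : Rˣ)) : R) - 1‖ * ‖(U₀ x ν : R)‖ := norm_mul_le _ _
    _ ≤ (windowCost K d L * (((d : ℝ) - 1) * ((L : ℝ) - 1)) * (q₁ + q₀)) * K :=
        mul_le_mul hW (hU₀ x ν).1 (norm_nonneg _) hW0
    _ = _ := mul_comm _ _

/-- [folklore] The relative comb gauge of a `K`-near-unitary pair is `G·G`-near-unitary ON THE SITES OF THE BLOCK,
`G = blockGaugeConst K d L` (pv04-g14 `nearUnitary_combGauge_block` BY NAME, sites of `B(z)` as offsets). -/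
theorem nearUnitary_combGauge_inBlock [NormOneClass R] {K : ℝ} (hK : 1 ≤ K) {U₀ U₁ : Cfg d R}
    (hU₀ : ∀ x ν, NearUnitary K (U₀ x ν)) (hU₁ : ∀ x ν, NearUnitary K (U₁ x ν)) (x : Site d) (hx : InBlock L z x) :
    NearUnitary (blockGaugeConst K d L * blockGaugeConst K d L) (combGauge U₀ U₁ z x) := by
  obtain ⟨k, hk, rfl⟩ := B8Lemma1Lattice.exists_offset_of_inBlock hx
  exact nearUnitary_combGauge_block hK hU₀ hU₁ z hk

section TransportP

variable [NormedAlgebra ℂ R] {F : Type*} [NormedAddCommGroup F] [NormedSpace ℂ F] [CompleteSpace F]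
variable {Fn : Fld d R → F} {𝒦 : Set (Fld d R)} {w r A : ℝ}

/-- **THE BLOCK TRANSPORT THEOREM FOR `P`-VALUED BLOCK GAUGES** (§3's `block_transport` verbatim with `BlockRelP P`):
`Fn` invariant under `BlockRelP P L z`, a birth slice (radius `r`, sup `A`, window `w`) on the affine chart, a base
`U₀ ∈ 𝒦`, ANY `U₁` and ANY gauge `g` with `P (g x)` on the sites of `B(z)` and `‖(U₁^g)⟨b⟩ − U₀⟨b⟩‖ ≤ δ ≤ w` on the
interior bonds: `‖Fn U₁ − Fn U₀‖ ≤ (4A/r)·δ`. [folklore] -/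
theorem block_transport_P {P : Rˣ → Prop} (hinv : GaugeInvariant (BlockRelP P L z) Fn)
    (hsl : BirthSlice Fn latMove latN 𝒦 w r A) (hr : 0 < r) (hA : 0 ≤ A) {U₀ U₁ : Cfg d R} (hU₀ : val U₀ ∈ 𝒦)
    {g : Site d → Rˣ} (hg : ∀ x, InBlock L z x → P (g x)) {δ : ℝ} (hδ : 0 ≤ δ) (hδw : δ ≤ w)
    (hdef : ∀ x ν, InBlock L z x → InBlock L z (x + e ν) → ‖(gaugeAct g U₁ x ν : R) - U₀ x ν‖ ≤ δ) :
    ‖Fn (val U₁) - Fn (val U₀)‖ ≤ 4 * A / r * δ := by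
  classical
  rcases hδ.eq_or_lt with h0 | hpos
  · subst h0
    have hrel : BlockRelP P L z (val U₁) (val U₀) := by
      refine ⟨g, hg, fun x ν hx hxν => ?_⟩
      have h := hdef x ν hx hxν
      rw [norm_le_zero_iff, sub_eq_zero] at h
      rw [val_apply, ← h]
      simp [gaugeAct]
    rw [sub_eq_zero_of_rel hinv hrel, norm_zero, mul_zero]
  · let D : Fld d R := fun x ν =>
      if InBlock L z x ∧ InBlock L z (x + e ν) then (gaugeAct g U₁ x ν : R) - U₀ x ν else 0
    have hD : ∀ x ν, ‖D x ν‖ ≤ δ := fun x ν => by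
      by_cases h : InBlock L z x ∧ InBlock L z (x + e ν)
      · simp only [D, if_pos h]; exact hdef x ν h.1 h.2
      · simp only [D, if_neg h, norm_zero]; exact hδ
    let dir : NDir d R := ⟨(D, δ), hD⟩
    have hrel : BlockRelP P L z (val U₁) (latMove (val U₀) dir 1) := by
      refine ⟨g, hg, fun x ν hx hxν => ?_⟩
      rw [latMove_one_apply, val_apply]
      show (U₀ x ν : R) + D x ν = _
      simp only [D, if_pos (And.intro hx hxν), gaugeAct, Units.val_mul, val_apply]
      abel
    exact transport_of_birthChart hinv hsl latMove_zero hr hA hU₀ ⟨dir, hpos, le_rfl, hrel⟩ hδw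

omit [NormedSpace ℂ F] [CompleteSpace F] in
/-- [folklore] **THE `RelGauge` WITNESS OF A `P`-VALUED BLOCK GAUGE** (§12's `relGauge_of_blockGauge` verbatim). -/
theorem relGauge_of_blockGaugeP {P : Rˣ → Prop} {U₀ U₁ : Cfg d R} {g : Site d → Rˣ}
    (hg : ∀ x, InBlock L z x → P (g x)) {δ : ℝ} (hδ : 0 < δ)
    (hdef : ∀ x ν, InBlock L z x → InBlock L z (x + e ν) → ‖(gaugeAct g U₁ x ν : R) - U₀ x ν‖ ≤ δ) :
    RelGauge (BlockRelP P L z) latMove latN (val U₀) (val U₁) δ := by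
  classical
  let D : Fld d R := fun x ν =>
    if InBlock L z x ∧ InBlock L z (x + e ν) then (gaugeAct g U₁ x ν : R) - U₀ x ν else 0
  have hD : ∀ x ν, ‖D x ν‖ ≤ δ := fun x ν => by
    by_cases h : InBlock L z x ∧ InBlock L z (x + e ν)
    · simp only [D, if_pos h]; exact hdef x ν h.1 h.2
    · simp only [D, if_neg h, norm_zero]; exact hδ.le
  refine ⟨⟨(D, δ), hD⟩, hδ, le_rfl, g, hg, fun x ν hx hxν => ?_⟩
  rw [latMove_one_apply, val_apply]
  show (U₀ x ν : R) + D x ν = _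
  simp only [D, if_pos (And.intro hx hxν), gaugeAct, Units.val_mul, val_apply]
  abel

/-- **THE WINDOW INSTANCE OF THE BLOCK TRANSPORT THEOREM** (the transport-level half of the carved residual
OG1′-RESID° (i)): `Fn` invariant under `BlockRelP (NearUnitary (G·G)) L z` (the (1.19)-type hypothesis at the constant
the comb gauge needs, `G = blockGaugeConst K d L`), a birth slice on the affine chart, `K ≥ 1`, `K`-near-unitary
`U₀ ∈ 𝒦` and `U₁` with plaquette sups `q₁, q₀` on `B(z)`, and any `δ` with
`K · windowCost K d L · (d−1)(L−1) · (q₁ + q₀) ≤ δ ≤ w`: `‖Fn U₁ − Fn U₀‖ ≤ (4A/r)·δ`.  Every analytic input is a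
hypothesis; the constant is pv04-g14's kernel-counted window cost times `K`. [folklore] -/
theorem block_transport_window [NormOneClass R] {K : ℝ} (hK : 1 ≤ K)
    (hinv : GaugeInvariant (BlockRelP (NearUnitary (blockGaugeConst K d L * blockGaugeConst K d L)) L z) Fn)
    (hsl : BirthSlice Fn latMove latN 𝒦 w r A) (hr : 0 < r) (hA : 0 ≤ A) {U₀ U₁ : Cfg d R} (hU₀𝒦 : val U₀ ∈ 𝒦)
    (hU₀ : ∀ x ν, NearUnitary K (U₀ x ν)) (hU₁ : ∀ x ν, NearUnitary K (U₁ x ν)) {q₀ q₁ δ : ℝ}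
    (hq₁ : PlaqSup L z (fun y ρ ν => ‖(plaq U₁ y ρ ν : R) - 1‖) q₁)
    (hq₀ : PlaqSup L z (fun y ρ ν => ‖(plaq U₀ y ρ ν : R) - 1‖) q₀) (hq₁0 : 0 ≤ q₁) (hq₀0 : 0 ≤ q₀)
    (hCδ : K * (windowCost K d L * (((d : ℝ) - 1) * ((L : ℝ) - 1)) * (q₁ + q₀)) ≤ δ) (hδ : 0 ≤ δ) (hδw : δ ≤ w) :
    ‖Fn (val U₁) - Fn (val U₀)‖ ≤ 4 * A / r * δ :=
  block_transport_P hinv hsl hr hA hU₀𝒦 (g := combGauge U₀ U₁ z)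
    (fun x hx => nearUnitary_combGauge_inBlock hK hU₀ hU₁ x hx) hδ hδw fun x ν hx hxν =>
    (window_bond_bound hK hU₀ hU₁ hq₁ hq₀ hq₁0 hq₀0 x ν hx hxν).trans hCδ

omit [NormedSpace ℂ F] [CompleteSpace F] in
/-- [folklore] THE WINDOW `RelGauge` WITNESS (§12's `relGauge_crude` on the complex window): under the hypotheses of
`block_transport_window` with `0 < δ`, the pair is `RelGauge (BlockRelP (NearUnitary (G·G)) L z)`-related at window
`δ` — the `hsize` witness shape of `T4BirthChartTransport.chartBound_of_response` for near-unitary pairs. -/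
theorem relGauge_window [NormOneClass R] {K : ℝ} (hK : 1 ≤ K) {U₀ U₁ : Cfg d R}
    (hU₀ : ∀ x ν, NearUnitary K (U₀ x ν)) (hU₁ : ∀ x ν, NearUnitary K (U₁ x ν)) {q₀ q₁ δ : ℝ}
    (hq₁ : PlaqSup L z (fun y ρ ν => ‖(plaq U₁ y ρ ν : R) - 1‖) q₁)
    (hq₀ : PlaqSup L z (fun y ρ ν => ‖(plaq U₀ y ρ ν : R) - 1‖) q₀) (hq₁0 : 0 ≤ q₁) (hq₀0 : 0 ≤ q₀)
    (hCδ : K * (windowCost K d L * (((d : ℝ) - 1) * ((L : ℝ) - 1)) * (q₁ + q₀)) ≤ δ) (hδ : 0 < δ) :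
    RelGauge (BlockRelP (NearUnitary (blockGaugeConst K d L * blockGaugeConst K d L)) L z) latMove latN
      (val U₀) (val U₁) δ :=
  relGauge_of_blockGaugeP (g := combGauge U₀ U₁ z) (fun x hx => nearUnitary_combGauge_inBlock hK hU₀ hU₁ x hx) hδ
    fun x ν hx hxν => (window_bond_bound hK hU₀ hU₁ hq₁ hq₀ hq₁0 hq₀0 x ν hx hxν).trans hCδ

end TransportP

end Window

/-! ## §16  THE FACTORISED PRESENTATION at transport level (v1.4): §3 applies as it stands

For complex pairs presented FACTORISED — `𝐔ᵢ = Wᵢ ⊙ Uᵢ` bondwise (`T4RelativeCombWindow.fmul`, pv04-g14 v1.2 §7), `Uᵢ`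
unitary-like (the 𝔊-valued parts), `Wᵢ` arbitrary units near `1` (the complex factors) — the comb gauge OF THE UNITARY
PARTS is unitary-like, so §3's `block_transport` applies with §2's `BlockRel` (G-valued invariance only), and pv04-g14's
`factorised_interior_bound_crude` BY NAME supplies the interior bond bound: LINEAR in the data, no `windowCost`.  This is
the typed transport-level form of the printed factorised mechanism (B12 (1.10)–(1.15) p.262, CONTEXT; GAPS A-t4lit1-3 and
A-t4lit1-3a); §15 remains the route for unfactorised pairs. [folklore] -/

section Factorised

open T4RelativeCombWindow (fmul fmul_apply factorised_interior_bound_crude)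

variable [NormedAlgebra ℂ R] {F : Type*} [NormedAddCommGroup F] [NormedSpace ℂ F] [CompleteSpace F]
variable {Fn : Fld d R → F} {𝒦 : Set (Fld d R)} {w r A : ℝ}

omit [NormedAlgebra ℂ R] in
/-- [folklore] THE FACTORISED BOND BOUND: under pv04-g14's `factorised_interior_bound_crude` hypotheses and
`‖W₀⟨b⟩‖ ≤ n₀` on the block, the interior bond deviation after the comb gauge of the unitary parts is at most
`n₀ · M · (n₁·(d−1)(L−1)(q₁+q₀) + w + 4t₀)` (their bound on `(𝐔₁^g)(b)·𝐔₀(b)⁻¹ − 1`, times `‖𝐔₀(b)‖ ≤ n₀·1`). -/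
theorem factorised_bond_bound [NormOneClass R] {U₀ U₁ W₀ W₁ : Cfg d R} {q₀ q₁ n₀ n₁ wd t₀ M : ℝ}
    (hU₀ : ∀ x ν, UnitaryLike (U₀ x ν)) (hU₁ : ∀ x ν, UnitaryLike (U₁ x ν))
    (hq₁ : PlaqSup L z (fun y ρ ν => ‖(plaq U₁ y ρ ν : R) - 1‖) q₁)
    (hq₀ : PlaqSup L z (fun y ρ ν => ‖(plaq U₀ y ρ ν : R) - 1‖) q₀) (hq : 0 ≤ q₁ + q₀)
    (hn₁ : ∀ x ν, InBlock L z x → ‖(W₁ x ν : R)‖ ≤ n₁)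
    (hwd : ∀ x ν, InBlock L z x → ‖(W₁ x ν : R) - W₀ x ν‖ ≤ wd)
    (ht₀ : ∀ x ν, InBlock L z x → ‖(W₀ x ν : R) - 1‖ ≤ t₀)
    (hM : ∀ x ν, InBlock L z x → ‖(((W₀ x ν)⁻¹ : Rˣ) : R)‖ ≤ M)
    (hn₀ : ∀ x ν, InBlock L z x → ‖(W₀ x ν : R)‖ ≤ n₀)
    (x : Site d) (ν : Fin d) (hx : InBlock L z x) (hxν : InBlock L z (x + e ν)) :
    ‖(gaugeAct (combGauge U₀ U₁ z) (fmul W₁ U₁) x ν : R) - fmul W₀ U₀ x ν‖ ≤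
      n₀ * (M * (n₁ * (((d : ℝ) - 1) * ((L : ℝ) - 1) * (q₁ + q₀)) + wd + 4 * t₀)) := by
  have hW := factorised_interior_bound_crude hU₀ hU₁ hq₁ hq₀ hq hn₁ hwd ht₀ hM x ν hx hxν
  have hW0 : 0 ≤ M * (n₁ * (((d : ℝ) - 1) * ((L : ℝ) - 1) * (q₁ + q₀)) + wd + 4 * t₀) := (norm_nonneg _).trans hW
  have e1 : (gaugeAct (combGauge U₀ U₁ z) (fmul W₁ U₁) x ν : R) - fmul W₀ U₀ x ν =
      ((((gaugeAct (combGauge U₀ U₁ z) (fmul W₁ U₁) x ν * (fmul W₀ U₀ x ν)⁻¹ : Rˣ)) : R) - 1) *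
        (fmul W₀ U₀ x ν : R) := by
    rw [sub_mul, one_mul, Units.val_mul, Units.inv_mul_cancel_right]
  have hb : ‖(fmul W₀ U₀ x ν : R)‖ ≤ n₀ := by
    rw [fmul_apply, Units.val_mul]
    calc _ ≤ ‖(W₀ x ν : R)‖ * ‖(U₀ x ν : R)‖ := norm_mul_le _ _
      _ ≤ n₀ * 1 := mul_le_mul (hn₀ x ν hx) (hU₀ x ν).1 (norm_nonneg _) ((norm_nonneg _).trans (hn₀ x ν hx))
      _ = n₀ := mul_one _
  rw [e1]
  calc _ ≤ ‖(((gaugeAct (combGauge U₀ U₁ z) (fmul W₁ U₁) x ν * (fmul W₀ U₀ x ν)⁻¹ : Rˣ)) : R) - 1‖ *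
      ‖(fmul W₀ U₀ x ν : R)‖ := norm_mul_le _ _
    _ ≤ (M * (n₁ * (((d : ℝ) - 1) * ((L : ℝ) - 1) * (q₁ + q₀)) + wd + 4 * t₀)) * n₀ :=
        mul_le_mul hW hb (norm_nonneg _) hW0
    _ = _ := mul_comm _ _

/-- **THE FACTORISED INSTANCE OF THE BLOCK TRANSPORT THEOREM**: `Fn` invariant under §2's `BlockRel L z` (G-valued
block gauges ONLY), a birth slice on the affine chart, a factorised base `W₀ ⊙ U₀ ∈ 𝒦` and `W₁ ⊙ U₁` with unitary-like
parts `U₀, U₁` (plaquette sups `q₁, q₀` on `B(z)`) and complex factors bounded on the block as in pv04-g14's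
`factorised_interior_bound_crude` (+ `‖W₀⟨b⟩‖ ≤ n₀`), and any `δ` with
`n₀·M·(n₁(d−1)(L−1)(q₁+q₀) + wd + 4t₀) ≤ δ ≤ w`: `‖Fn (W₁⊙U₁) − Fn (W₀⊙U₀)‖ ≤ (4A/r)·δ` — the block gauge is the comb
gauge of the UNITARY parts; LINEAR constants, no window cost. [folklore] -/
theorem block_transport_factorised [NormOneClass R] (hinv : GaugeInvariant (BlockRel L z) Fn)
    (hsl : BirthSlice Fn latMove latN 𝒦 w r A) (hr : 0 < r) (hA : 0 ≤ A) {U₀ U₁ W₀ W₁ : Cfg d R}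
    (h𝒦 : val (fmul W₀ U₀) ∈ 𝒦) (hU₀ : ∀ x ν, UnitaryLike (U₀ x ν)) (hU₁ : ∀ x ν, UnitaryLike (U₁ x ν))
    {q₀ q₁ n₀ n₁ wd t₀ M δ : ℝ}
    (hq₁ : PlaqSup L z (fun y ρ ν => ‖(plaq U₁ y ρ ν : R) - 1‖) q₁)
    (hq₀ : PlaqSup L z (fun y ρ ν => ‖(plaq U₀ y ρ ν : R) - 1‖) q₀) (hq : 0 ≤ q₁ + q₀)
    (hn₁ : ∀ x ν, InBlock L z x → ‖(W₁ x ν : R)‖ ≤ n₁)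
    (hwd : ∀ x ν, InBlock L z x → ‖(W₁ x ν : R) - W₀ x ν‖ ≤ wd)
    (ht₀ : ∀ x ν, InBlock L z x → ‖(W₀ x ν : R) - 1‖ ≤ t₀)
    (hM : ∀ x ν, InBlock L z x → ‖(((W₀ x ν)⁻¹ : Rˣ) : R)‖ ≤ M)
    (hn₀ : ∀ x ν, InBlock L z x → ‖(W₀ x ν : R)‖ ≤ n₀)
    (hCδ : n₀ * (M * (n₁ * (((d : ℝ) - 1) * ((L : ℝ) - 1) * (q₁ + q₀)) + wd + 4 * t₀)) ≤ δ) (hδ : 0 ≤ δ)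
    (hδw : δ ≤ w) : ‖Fn (val (fmul W₁ U₁)) - Fn (val (fmul W₀ U₀))‖ ≤ 4 * A / r * δ :=
  block_transport hinv hsl hr hA h𝒦 (T4RelativeComb.unitaryLike_combGauge hU₀ hU₁ z) hδ hδw fun x ν hx hxν =>
    (factorised_bond_bound hU₀ hU₁ hq₁ hq₀ hq hn₁ hwd ht₀ hM hn₀ x ν hx hxν).trans hCδ

omit [NormedSpace ℂ F] [CompleteSpace F] in
/-- [folklore] THE FACTORISED `RelGauge` WITNESS (§12's export for factorised pairs, `0 < δ`). -/
theorem relGauge_factorised [NormOneClass R] {U₀ U₁ W₀ W₁ : Cfg d R} (hU₀ : ∀ x ν, UnitaryLike (U₀ x ν))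
    (hU₁ : ∀ x ν, UnitaryLike (U₁ x ν)) {q₀ q₁ n₀ n₁ wd t₀ M δ : ℝ}
    (hq₁ : PlaqSup L z (fun y ρ ν => ‖(plaq U₁ y ρ ν : R) - 1‖) q₁)
    (hq₀ : PlaqSup L z (fun y ρ ν => ‖(plaq U₀ y ρ ν : R) - 1‖) q₀) (hq : 0 ≤ q₁ + q₀)
    (hn₁ : ∀ x ν, InBlock L z x → ‖(W₁ x ν : R)‖ ≤ n₁)
    (hwd : ∀ x ν, InBlock L z x → ‖(W₁ x ν : R) - W₀ x ν‖ ≤ wd)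
    (ht₀ : ∀ x ν, InBlock L z x → ‖(W₀ x ν : R) - 1‖ ≤ t₀)
    (hM : ∀ x ν, InBlock L z x → ‖(((W₀ x ν)⁻¹ : Rˣ) : R)‖ ≤ M)
    (hn₀ : ∀ x ν, InBlock L z x → ‖(W₀ x ν : R)‖ ≤ n₀)
    (hCδ : n₀ * (M * (n₁ * (((d : ℝ) - 1) * ((L : ℝ) - 1) * (q₁ + q₀)) + wd + 4 * t₀)) ≤ δ) (hδ : 0 < δ) :
    RelGauge (BlockRel L z) latMove latN (val (fmul W₀ U₀)) (val (fmul W₁ U₁)) δ :=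
  relGauge_of_blockGauge (T4RelativeComb.unitaryLike_combGauge hU₀ hU₁ z) hδ fun x ν hx hxν =>
    (factorised_bond_bound hU₀ hU₁ hq₁ hq₀ hq hn₁ hwd ht₀ hM hn₀ x ν hx hxν).trans hCδ

end Factorised

end Literature.MathematicalPhysics.QuantumFieldTheory.Balaban1983to89.T4BlockTransport
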